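import Mathlib.LinearAlgebra.Charpoly.Basic
import Literature.NumberTheory.EllipticCurves.EisensteinNewformLevelRaisingInertiaNewvectorProofs
import Literature.NumberTheory.Automorphic.JacquetLemma
import Literature.NumberTheory.Automorphic.ParabolicInductionModulusProofs
import Literature.NumberTheory.Automorphic.AddCharConductorExponent
import HarnessLib

/-!
# Whittaker functions of `GL₂(F)` on the torus and the Jacquet module: the pole bound
# `deg L(s, π × 1) ≤ dim` (image of the `diag(𝒪ˣ, 1)`-fixed vectors in `π_N`)

Topic `Literature/NumberTheory/Automorphic`; proof file (theorems only: no definition, no named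
fact, no instance).  Let `F` be a non-archimedean local field (`q = #k_F`, `|·| = |·|_F`), `π` a
smooth representation of `GL₂(F)` on `V`, `ψ ≠ 1` a continuous additive character, `Λ` a
`ψ`-Whittaker functional and `W_v(g) = Λ(π(g) v)` the Whittaker functions (`whittakerModel`).  For
the torus values `Φ_v(a) = W_v(d(a, 1))` (`d(a, b) = diagGL2 a b`) we prove the elementary half of
the theory of the Kirillov model (Jacquet–Langlands 1970, §2, Props. 2.8–2.10 and Lemma 2.13.1;
Godement, *Notes on Jacquet–Langlands*, §1.2–1.3; Bump 1997, §4.4 and Prop. 4.7.4):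

* `Φ_{π(d(t,1)) v}(a) = Φ_v(a t)`, `Φ_{π(n(x)) v}(a) = ψ(a x) Φ_v(a)`
  (`whittakerModel_diagGL2_diagGL2`, `whittakerModel_unipotentGL2_diagGL2`);
* `Φ_v(a) = 0` for `|a|` large (`exists_whittakerModel_diagGL2_eq_zero_of_not_mem`), `Φ_v` is
  locally constant on `Fˣ` (`isLocallyConstant_whittakerModel_diagGL2`);
* **the Jacquet module controls the germ at `0`**: `Φ_v` vanishes near `0` for `v ∈ V(N)`
  (`exists_whittakerModel_diagGL2_eq_zero_of_mem_ker`), hence for a finite-dimensional subspace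
  `M` of the Jacquet module `V_N = V / V(N)` (`(restrictUnipotentGL F id π).Coinvariants`) stable
  under `d(ϖ, 1)` and containing the class of `v`, the characteristic polynomial
  `Q = ∑ qᵢ Xⁱ` of `d(ϖ, 1)` on `M` gives the **torus recursion** `∑ᵢ qᵢ Φ_v(a ϖⁱ) = 0` for `|a|`
  small (`exists_monic_forall_sum_coeff_mul_whittakerModel_eq_zero`), so `Φ_v` grows at most
  like `|a|^{-N}` at `0` (`exists_norm_le_indicator_rpow_of_recursion`) and the `GL₂ × GL₁` Rankin–Selberg
  integral `Ψ(s; W_v, 1) = ∫_{Fˣ} Φ_v(a) |a|^{s-1/2} d^×a` converges absolutely for `re s ≫ 0`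
  (`integrable_mul_cpow_of_norm_le`);
* **rationality with controlled denominator**: `Q(q^{1/2} q^{-s}) · Ψ(s; W_v, 1)` is a Laurent
  polynomial in `q^{-s}` (`exists_pow_mul_sum_mul_integral_eq_eval`: substituting `a ↦ a ϖⁱ` and
  integrating the recursion over the finitely many shells where it fails);
* **the pole bound** (`natDegree_le_finrank_of_hasRSLFactor`): averaging `v` over `d(𝒪ˣ, 1)` does
  not change `Ψ(s; W_v, 1)` (the invariant measure on `GL₁(F) ⧸ U₁ = Fˣ` is a Haar measure), so
  every `Ψ` is `(Laurent) / Q_M(q^{1/2} q^{-s})` for `Q_M` the characteristic polynomial of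
  `d(ϖ, 1)` on the image `M` in `V_N` of the `d(𝒪ˣ, 1)`-fixed vectors; comparing with clause (b)
  of `HasRSLFactor` ("`1/P` is a `ℂ[q^{∓s}]`-combination of zeta integrals", JPSS 1983,
  Thm. 2.7 (ii)) exactly as in `HasRSLFactor.exists_X_pow_mul_eq` gives `P ∣ X^i Q_M(q^{1/2} X)`,
  and `P(0) = 1` gives `P ∣ Q_M(q^{1/2} X)`, whence `deg P ≤ dim M`.

This is the local input of the classification-free proof that a generic irreducible
representation of `GL₂(F)` whose standard `L`-factor has degree `2` is spherical (Jacquet–Langlands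
1970, Prop. 3.5 with Thm. 2.18; Gelbart 1975, Thm. 6.15): the number of poles of `L(s, π)` is at
most the number of unramified exponents of the Jacquet module.

## References

* H. Jacquet, R. P. Langlands, *Automorphic forms on GL(2)*, LNM 114 (1970), §2 (Props. 2.8–2.10,
  Lemma 2.13.1), Prop. 3.5. [JacquetLanglands1970]
* R. Godement, *Notes on Jacquet–Langlands' theory*, IAS (1970), §1.2–1.3.
* D. Bump, *Automorphic forms and representations* (1997), §4.4, Prop. 4.7.4. [Bump1997]
* H. Jacquet, I. I. Piatetski-Shapiro, J. Shalika, *Rankin–Selberg convolutions*, Amer. J. Math.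
  105 (1983), Thm. 2.7 (ii). [JacquetPiatetskiShapiroShalika1983]
* S. Gelbart, *Automorphic forms on adele groups* (1975), Thm. 6.15. [Gelbart1975]
-/

noncomputable section

open scoped MatrixGroups NNReal ENNReal
open MeasureTheory ValuativeRel Polynomial Filter
  Literature.NumberTheory.GaloisRepresentations.IsNonarchimedeanLocalField
  Literature.NumberTheory.EllipticCurves.Hida2000Thm326

namespace Literature.NumberTheory.Automorphic

/-! ### Part 1: torus values of Whittaker functions -/

section Algebra

variable {F : Type*} [Field F] {V : Type*} [AddCommGroup V] [Module ℂ V]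
  (π : Representation ℂ (GL (Fin 2) F) V)

/-- `W_{π(d(t,1)) v}(d(a, 1)) = W_v(d(a t, 1))`. [folklore] -/
theorem whittakerModel_diagGL2_diagGL2 (Λ : Module.Dual ℂ V) (v : V) (a t : Fˣ) :
    whittakerModel π Λ (π (diagGL2 t 1) v) (diagGL2 a 1) = whittakerModel π Λ v (diagGL2 (a * t) 1) := by
  rw [← whittakerModel_apply_apply_mul, ← diagGL2_mul, mul_one]

/-- `W_{π(d(t,1))^i v}(d(a, 1)) = W_v(d(a t^i, 1))`. [folklore] -/
theorem whittakerModel_diagGL2_pow_diagGL2 (Λ : Module.Dual ℂ V) (v : V) (a t : Fˣ) (i : ℕ) :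
    whittakerModel π Λ (((π (diagGL2 t 1)) ^ i) v) (diagGL2 a 1) =
      whittakerModel π Λ v (diagGL2 (a * t ^ i) 1) := by
  induction i generalizing a with
  | zero => simp
  | succ i ih =>
    rw [pow_succ', Module.End.mul_apply, whittakerModel_diagGL2_diagGL2, ih, mul_assoc, ← pow_succ']

/-- `W_{π(n(x)) v}(d(a, 1)) = ψ(a x) W_v(d(a, 1))` for a `ψ`-Whittaker functional. [folklore] -/
theorem whittakerModel_unipotentGL2_diagGL2 {ψ : AddChar F Circle} {Λ : Module.Dual ℂ V}
    (hΛ : Λ ∈ whittakerFunctionals π ψ) (v : V) (a : Fˣ) (x : F) :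
    whittakerModel π Λ (π ((unipotentGL2 x : ↥(upperUnitriangular (Fin 2) F)) : GL (Fin 2) F) v)
        (diagGL2 a 1) = ψ ((a : F) * x) * whittakerModel π Λ v (diagGL2 a 1) := by
  rw [← whittakerModel_apply_apply_mul, diagGL2_mul_unipotentGL2, whittakerModel_apply,
    whittakerModel_apply, map_mul, Module.End.mul_apply, (mem_whittakerFunctionals_iff Λ).1 hΛ,
    whittakerCharFun_unipotentGL2]

/-- Elements of the unipotent radical `U_id ≤ P_id` of `GL₂` are the `n(x)`. [folklore] -/
theorem exists_coe_eq_unipotentGL2 (u : ↥(unipotentRadicalP F (id : Fin 2 → Fin 2))) :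
    ∃ x : F, ((u : ↥(standardParabolicGL F (id : Fin 2 → Fin 2))) : GL (Fin 2) F) =
      ((unipotentGL2 x : ↥(upperUnitriangular (Fin 2) F)) : GL (Fin 2) F) := by
  have hu : ((u : ↥(standardParabolicGL F (id : Fin 2 → Fin 2))) : GL (Fin 2) F) ∈
      upperUnitriangular (Fin 2) F := ⟨u, u.2, rfl⟩
  refine ⟨(((u : ↥(standardParabolicGL F (id : Fin 2 → Fin 2))) : GL (Fin 2) F) : Matrix (Fin 2) (Fin 2) F) 0 1, ?_⟩
  have h := unipotentGL2_entry (⟨_, hu⟩ : ↥(upperUnitriangular (Fin 2) F))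
  exact (congrArg Subtype.val h).symm

end Algebra

section Torus

variable {F : Type*} [Field F] [ValuativeRel F] [TopologicalSpace F] [IsNonarchimedeanLocalField F]
  {V : Type*} [AddCommGroup V] [Module ℂ V] (π : Representation ℂ (GL (Fin 2) F) V)

omit [ValuativeRel F] [IsNonarchimedeanLocalField F] in
/-- `a ↦ d(a, 1)` is continuous `Fˣ → GL₂(F)`. [folklore] -/
theorem continuous_unitsDiagGL2_one : Continuous fun a : Fˣ => (diagGL2 a 1 : GL (Fin 2) F) := by
  refine Units.continuous_iff.2 ⟨?_, ?_⟩
  · show Continuous fun a : Fˣ => ((diagGL2 a 1 : GL (Fin 2) F) : Matrix (Fin 2) (Fin 2) F)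
    have : (fun a : Fˣ => ((diagGL2 a 1 : GL (Fin 2) F) : Matrix (Fin 2) (Fin 2) F)) =
        fun a : Fˣ => Matrix.diagonal ![(a : F), 1] := by
      funext a
      rw [coe_diagGL2]
      ext i j
      fin_cases i <;> fin_cases j <;> simp
    rw [this]
    refine Continuous.matrix_diagonal ?_
    refine continuous_pi fun i => ?_
    fin_cases i
    · exact Units.continuous_val
    · exact continuous_const
  · show Continuous fun a : Fˣ => ((↑((diagGL2 a 1 : GL (Fin 2) F)⁻¹)) : Matrix (Fin 2) (Fin 2) F)
    have : (fun a : Fˣ => ((↑((diagGL2 a 1 : GL (Fin 2) F)⁻¹)) : Matrix (Fin 2) (Fin 2) F)) =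
        fun a : Fˣ => Matrix.diagonal ![((a⁻¹ : Fˣ) : F), 1] := by
      funext a
      rw [show (diagGL2 a 1)⁻¹ = diagGL2 a⁻¹ 1 by
        rw [inv_eq_iff_mul_eq_one, ← diagGL2_mul, mul_inv_cancel, mul_one, diagGL2_one], coe_diagGL2]
      ext i j
      fin_cases i <;> fin_cases j <;> simp
    rw [this]
    refine Continuous.matrix_diagonal ?_
    refine continuous_pi fun i => ?_
    fin_cases i
    · exact Units.continuous_coe_inv
    · exact continuous_const

/-- **Local constancy on the torus**: for a smooth vector `v`, `a ↦ W_v(d(a, 1))` is locally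
constant on `Fˣ`. [folklore] -/
theorem isLocallyConstant_whittakerModel_diagGL2 (Λ : Module.Dual ℂ V) {v : V} (hv : π.IsSmoothVector v) :
    IsLocallyConstant fun a : Fˣ => whittakerModel π Λ v (diagGL2 a 1) := by
  refine (IsLocallyConstant.iff_exists_open _).2 fun a => ?_
  set H : Set Fˣ := (fun t : Fˣ => (diagGL2 t 1 : GL (Fin 2) F)) ⁻¹' (π.stabilizerSubgroup v : Set _)
    with hH
  have hHo : IsOpen H := hv.preimage continuous_unitsDiagGL2_one
  refine ⟨(fun t => a⁻¹ * t) ⁻¹' H, hHo.preimage (continuous_const_mul _), ?_, fun b hb => ?_⟩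
  · show a⁻¹ * a ∈ H
    rw [inv_mul_cancel, hH, Set.mem_preimage, diagGL2_one]
    exact (π.stabilizerSubgroup v).one_mem
  · have hb' : π (diagGL2 (a⁻¹ * b) 1) v = v := hb
    calc whittakerModel π Λ v (diagGL2 b 1)
        = whittakerModel π Λ v (diagGL2 (a * (a⁻¹ * b)) 1) := by rw [mul_inv_cancel_left]
      _ = whittakerModel π Λ (π (diagGL2 (a⁻¹ * b) 1) v) (diagGL2 a 1) :=
          (whittakerModel_diagGL2_diagGL2 π Λ v a _).symm
      _ = whittakerModel π Λ v (diagGL2 a 1) := by rw [hb']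

/-- For a smooth vector `v`, some ball `𝔭^j` satisfies `n(x) v = v` for `x ∈ 𝔭^j`. [folklore] -/
theorem exists_forall_unipotentGL2_apply_eq {v : V} (hv : π.IsSmoothVector v) :
    ∃ j : ℤ, ∀ x ∈ primePowBall F j,
      π ((unipotentGL2 x : ↥(upperUnitriangular (Fin 2) F)) : GL (Fin 2) F) v = v := by
  have hcont : Continuous fun x : F =>
      ((unipotentGL2 x : ↥(upperUnitriangular (Fin 2) F)) : GL (Fin 2) F) :=
    continuous_subtype_val.comp continuous_unipotentGL2
  have hmem : (fun x : F => ((unipotentGL2 x : ↥(upperUnitriangular (Fin 2) F)) : GL (Fin 2) F)) ⁻¹'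
      (π.stabilizerSubgroup v : Set _) ∈ nhds (0 : F) := by
    refine (hv.preimage hcont).mem_nhds ?_
    show ((unipotentGL2 (0 : F) : ↥(upperUnitriangular (Fin 2) F)) : GL (Fin 2) F) ∈ π.stabilizerSubgroup v
    rw [unipotentGL2_zero, Subgroup.coe_one]
    exact (π.stabilizerSubgroup v).one_mem
  obtain ⟨j, hj⟩ := exists_primePowBall_subset_of_mem_nhds_zero hmem
  exact ⟨j, fun x hx => hj hx⟩

/-- **Vanishing at infinity on the torus**: for `ψ` continuous non-trivial, a `ψ`-Whittaker
functional `Λ` and a smooth vector `v`, `W_v(d(a, 1)) = 0` off some ball `𝔭^k`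
(`W_v(d(a,1)) = W_{n(x) v}(d(a,1)) = ψ(a x) W_v(d(a,1))` with `ψ(a x) ≠ 1`).
(Jacquet–Langlands 1970, Prop. 2.8 (i); Bump 1997, Prop. 4.7.4.) [cite: JacquetLanglands1970, Prop. 2.8] -/
theorem exists_whittakerModel_diagGL2_eq_zero_of_not_mem {ψ : AddChar F Circle}
    (hψ : ψ.IsContinuousNontrivial) {Λ : Module.Dual ℂ V} (hΛ : Λ ∈ whittakerFunctionals π ψ)
    {v : V} (hv : π.IsSmoothVector v) :
    ∃ k : ℤ, ∀ a : Fˣ, (a : F) ∉ primePowBall F k → whittakerModel π Λ v (diagGL2 a 1) = 0 := by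
  obtain ⟨m, hm⟩ := hψ.exists_hasConductorExp
  obtain ⟨j, hj⟩ := exists_forall_unipotentGL2_apply_eq π hv
  refine ⟨m - j, fun a ha => ?_⟩
  obtain ⟨x₀, hx₀, hne⟩ := exists_mem_primePowBall_addChar_mul_ne_one hm (n := j) ha
  have h := whittakerModel_unipotentGL2_diagGL2 π hΛ v a x₀
  rw [hj x₀ hx₀, mul_comm (a : F) x₀] at h
  have h' : ((ψ (x₀ * a) : ℂ) - 1) * whittakerModel π Λ v (diagGL2 a 1) = 0 := by
    rw [sub_mul, one_mul, ← h, sub_self]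
  rcases mul_eq_zero.1 h' with h1 | h1
  · exact absurd (Subtype.ext (by simpa [sub_eq_zero] using h1)) hne
  · exact h1

/-- **`V(N)` has trivial germ at `0`**: if `v` lies in the kernel `V(N) = ⟨π(n) w - w⟩` of
`V → V_N`, then `W_v(d(a, 1)) = 0` for `a` in some ball `𝔭^k` (for a generator,
`W_{π(n(x))w - w}(d(a,1)) = (ψ(a x) - 1) W_w(d(a,1))` and `ψ(a x) = 1` for `|a|` small).
(Jacquet–Langlands 1970, Prop. 2.9 and Lemma 2.13.1; Bump 1997, §4.4.) [cite: JacquetLanglands1970, Prop. 2.9] -/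
theorem exists_whittakerModel_diagGL2_eq_zero_of_mem_ker {ψ : AddChar F Circle}
    (hψ : ψ.IsContinuousNontrivial) {Λ : Module.Dual ℂ V} (hΛ : Λ ∈ whittakerFunctionals π ψ) {v : V}
    (hv : v ∈ Representation.Coinvariants.ker (Representation.restrictUnipotentGL F (id : Fin 2 → Fin 2) π)) :
    ∃ k : ℤ, ∀ a : Fˣ, (a : F) ∈ primePowBall F k → whittakerModel π Λ v (diagGL2 a 1) = 0 := by
  obtain ⟨m, hm⟩ := hψ.exists_hasConductorExp
  refine Submodule.span_induction (p := fun w _ => ∃ k : ℤ, ∀ a : Fˣ, (a : F) ∈ primePowBall F k →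
    whittakerModel π Λ w (diagGL2 a 1) = 0) ?_ ?_ ?_ ?_ hv
  · rintro _ ⟨⟨u, w⟩, rfl⟩
    obtain ⟨x, hx⟩ := exists_coe_eq_unipotentGL2 u
    obtain ⟨j, hj⟩ := exists_mem_primePowBall (F := F) x
    refine ⟨m - j, fun a ha => ?_⟩
    dsimp only
    change whittakerModel π Λ (π ((u : ↥(standardParabolicGL F (id : Fin 2 → Fin 2))) : GL (Fin 2) F) w - w)
      (diagGL2 a 1) = 0
    rw [map_sub, Pi.sub_apply, hx, whittakerModel_unipotentGL2_diagGL2 π hΛ w a x]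
    have hax : (a : F) * x ∈ primePowBall F m := by
      have := mul_mem_primePowBall ha hj
      rwa [sub_add_cancel] at this
    rw [hm.1 _ hax, Circle.coe_one, one_mul, sub_self]
  · exact ⟨0, fun a _ => by rw [map_zero, Pi.zero_apply]⟩
  · rintro w w' - - ⟨k, hk⟩ ⟨k', hk'⟩
    refine ⟨max k k', fun a ha => ?_⟩
    rw [map_add, Pi.add_apply, hk a (primePowBall_antitone (le_max_left _ _) ha),
      hk' a (primePowBall_antitone (le_max_right _ _) ha), add_zero]
  · rintro c w - ⟨k, hk⟩
    exact ⟨k, fun a ha => by rw [map_smul, Pi.smul_apply, hk a ha, smul_zero]⟩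

end Torus

/-! ### Part 2: the torus recursion from a finite-dimensional piece of the Jacquet module -/

section Recursion

variable {F : Type*} [Field F] {V : Type*} [AddCommGroup V] [Module ℂ V]
  (π : Representation ℂ (GL (Fin 2) F) V)

/-- Diagonal matrices lie in the upper Borel `P_id`. [folklore] -/
theorem diagGL2_mem_standardParabolicGL_fin_two (a b : Fˣ) :
    diagGL2 a b ∈ standardParabolicGL F (id : Fin 2 → Fin 2) := by
  rw [mem_standardParabolicGL_iff, coe_diagGL2]
  intro i j hij
  fin_cases i <;> fin_cases j <;> simp at hij ⊢

/-- The torus acts on the Jacquet module `V_N` by `[v] ↦ [π(d(a,b)) v]`. [folklore] -/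
theorem jacquetGL_leviProjection_diagGL2_mk (a b : Fˣ) (v : V) :
    Representation.jacquetGL F (id : Fin 2 → Fin 2) π
        (leviProjection F (id : Fin 2 → Fin 2) ⟨diagGL2 a b, diagGL2_mem_standardParabolicGL_fin_two a b⟩)
        (Representation.Coinvariants.mk (Representation.restrictUnipotentGL F (id : Fin 2 → Fin 2) π) v) =
      Representation.Coinvariants.mk (Representation.restrictUnipotentGL F (id : Fin 2 → Fin 2) π)
        (π (diagGL2 a b) v) :=
  jacquetGL_leviProjection_mk F (id : Fin 2 → Fin 2) π _ v

/-- Powers: `[π(d(a,b))^i v] = T^i [v]` for the torus operator `T` on `V_N`. [folklore] -/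
theorem jacquetGL_leviProjection_diagGL2_pow_mk (a b : Fˣ) (v : V) (i : ℕ) :
    ((Representation.jacquetGL F (id : Fin 2 → Fin 2) π
        (leviProjection F (id : Fin 2 → Fin 2) ⟨diagGL2 a b, diagGL2_mem_standardParabolicGL_fin_two a b⟩)) ^ i)
        (Representation.Coinvariants.mk (Representation.restrictUnipotentGL F (id : Fin 2 → Fin 2) π) v) =
      Representation.Coinvariants.mk (Representation.restrictUnipotentGL F (id : Fin 2 → Fin 2) π)
        (((π (diagGL2 a b)) ^ i) v) := by
  induction i with
  | zero => simp
  | succ i ih => rw [pow_succ', Module.End.mul_apply, ih, jacquetGL_leviProjection_diagGL2_mk, pow_succ',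
      Module.End.mul_apply]

/-- `[Q(π(d(a,b))) v] = Q(T) [v]` for every polynomial `Q`. [folklore] -/
theorem mk_aeval_diagGL2 (a b : Fˣ) (Q : ℂ[X]) (v : V) :
    Representation.Coinvariants.mk (Representation.restrictUnipotentGL F (id : Fin 2 → Fin 2) π)
        (aeval (π (diagGL2 a b)) Q v) =
      aeval (Representation.jacquetGL F (id : Fin 2 → Fin 2) π
        (leviProjection F (id : Fin 2 → Fin 2) ⟨diagGL2 a b, diagGL2_mem_standardParabolicGL_fin_two a b⟩)) Q
        (Representation.Coinvariants.mk (Representation.restrictUnipotentGL F (id : Fin 2 → Fin 2) π) v) := by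
  rw [aeval_eq_sum_range, aeval_eq_sum_range, LinearMap.sum_apply, LinearMap.sum_apply, map_sum]
  refine Finset.sum_congr rfl fun i _ => ?_
  rw [LinearMap.smul_apply, LinearMap.smul_apply, map_smul, jacquetGL_leviProjection_diagGL2_pow_mk]

/-- Values of a polynomial in a restricted endomorphism are the values of the polynomial in the
endomorphism. [folklore] -/
theorem coe_aeval_restrict_apply {W : Type*} [AddCommGroup W] [Module ℂ W] (f : W →ₗ[ℂ] W)
    {p : Submodule ℂ W} (h : ∀ x ∈ p, f x ∈ p) (Q : ℂ[X]) (x : p) :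
    ((aeval (f.restrict h) Q x : p) : W) = aeval f Q (x : W) := by
  rw [aeval_eq_sum_range, aeval_eq_sum_range, LinearMap.sum_apply, LinearMap.sum_apply,
    Submodule.coe_sum]
  refine Finset.sum_congr rfl fun i _ => ?_
  rw [LinearMap.smul_apply, LinearMap.smul_apply, Submodule.coe_smul, Module.End.pow_restrict,
    LinearMap.coe_restrict_apply]

/-- `W_{Q(π(d(t,1))) v}(d(a, 1)) = ∑ᵢ Q.coeff i · W_v(d(a tⁱ, 1))`. [folklore] -/
theorem whittakerModel_aeval_diagGL2 (Λ : Module.Dual ℂ V) (Q : ℂ[X]) (v : V) (a t : Fˣ) :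
    whittakerModel π Λ (aeval (π (diagGL2 t 1)) Q v) (diagGL2 a 1) =
      ∑ i ∈ Finset.range (Q.natDegree + 1), Q.coeff i * whittakerModel π Λ v (diagGL2 (a * t ^ i) 1) := by
  rw [aeval_eq_sum_range, LinearMap.sum_apply, map_sum, Finset.sum_apply]
  refine Finset.sum_congr rfl fun i _ => ?_
  rw [LinearMap.smul_apply, map_smul, Pi.smul_apply, smul_eq_mul, whittakerModel_diagGL2_pow_diagGL2]

variable [ValuativeRel F] [TopologicalSpace F] [IsNonarchimedeanLocalField F]

/-- **The torus recursion.**  Let `M` be a finite-dimensional subspace of the Jacquet module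
`V_N` stable under the torus element `d(t, 1)` (`t ∈ Fˣ`).  Then there is a MONIC polynomial
`Q = ∑ qᵢ Xⁱ` of degree `dim M` — the characteristic polynomial of `d(t, 1)` on `M` — such that
for every `v` whose class lies in `M`, `∑ᵢ qᵢ W_v(d(a tⁱ, 1)) = 0` for all `a` in some ball
`𝔭^k` (Cayley–Hamilton: `Q(d(t,1)) v ∈ V(N)`, then `exists_whittakerModel_diagGL2_eq_zero_of_mem_ker`).
This is the finite-dimensionality statement `𝒦(π) / 𝒮(Fˣ) ≅ π_N` of the Kirillov model read
backwards (Jacquet–Langlands 1970, Prop. 2.9 and Lemma 2.13.1; Godement 1970, §1.3, Lemma 4;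
Bump 1997, Thm. 4.7.2–Prop. 4.7.4). [cite: JacquetLanglands1970, Prop. 2.9, Lemma 2.13.1] -/
theorem exists_monic_forall_sum_coeff_mul_whittakerModel_eq_zero {ψ : AddChar F Circle}
    (hψ : ψ.IsContinuousNontrivial) (t : Fˣ)
    (M : Submodule ℂ (Representation.restrictUnipotentGL F (id : Fin 2 → Fin 2) π).Coinvariants)
    [FiniteDimensional ℂ M]
    (hM : ∀ v : V, Representation.Coinvariants.mk (Representation.restrictUnipotentGL F (id : Fin 2 → Fin 2) π) v ∈ M →
      Representation.Coinvariants.mk (Representation.restrictUnipotentGL F (id : Fin 2 → Fin 2) π)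
        (π (diagGL2 t 1) v) ∈ M) :
    ∃ Q : ℂ[X], Q.Monic ∧ Q.natDegree = Module.finrank ℂ M ∧
      ∀ {Λ : Module.Dual ℂ V}, Λ ∈ whittakerFunctionals π ψ →
      ∀ v : V, Representation.Coinvariants.mk (Representation.restrictUnipotentGL F (id : Fin 2 → Fin 2) π) v ∈ M →
        ∃ k : ℤ, ∀ a : Fˣ, (a : F) ∈ primePowBall F k →
          ∑ i ∈ Finset.range (Q.natDegree + 1), Q.coeff i * whittakerModel π Λ v (diagGL2 (a * t ^ i) 1) = 0 := by
  set T : Module.End ℂ (Representation.restrictUnipotentGL F (id : Fin 2 → Fin 2) π).Coinvariants :=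
    Representation.jacquetGL F (id : Fin 2 → Fin 2) π
      (leviProjection F (id : Fin 2 → Fin 2) ⟨diagGL2 t 1, diagGL2_mem_standardParabolicGL_fin_two t 1⟩) with hT
  have hT' : ∀ x ∈ M, T x ∈ M := by
    intro x hx
    obtain ⟨v, rfl⟩ := Representation.Coinvariants.mk_surjective _ x
    rw [hT, jacquetGL_leviProjection_diagGL2_mk]
    exact hM v hx
  set Q : ℂ[X] := (T.restrict hT').charpoly with hQ
  refine ⟨Q, LinearMap.charpoly_monic _, LinearMap.charpoly_natDegree _, fun {Λ} hΛ v hv => ?_⟩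
  -- Cayley–Hamilton: `[Q(π(d(t,1))) v] = Q(T) [v] = 0`
  have hker : aeval (π (diagGL2 t 1)) Q v ∈
      Representation.Coinvariants.ker (Representation.restrictUnipotentGL F (id : Fin 2 → Fin 2) π) := by
    rw [← Representation.Coinvariants.mk_eq_zero, mk_aeval_diagGL2, ← hT]
    have h := coe_aeval_restrict_apply T hT' Q ⟨_, hv⟩
    rw [hQ, LinearMap.aeval_self_charpoly, LinearMap.zero_apply, ZeroMemClass.coe_zero] at h
    rw [hQ]
    exact h.symm
  obtain ⟨k, hk⟩ := exists_whittakerModel_diagGL2_eq_zero_of_mem_ker π hψ hΛ hker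
  refine ⟨k, fun a ha => ?_⟩
  rw [← whittakerModel_aeval_diagGL2]
  exact hk a ha

end Recursion

/-! ### Part 3: exponential growth at `0` from the recursion; absolute convergence -/

section Growth

variable {F : Type*} [Field F] [ValuativeRel F] [TopologicalSpace F] [IsNonarchimedeanLocalField F]

/-- `|a ϖ^i| = |a| q^{-i}` lands in the shell shifted by `i`. [folklore] -/
theorem normAbs_mul_pow_eq {ϖ : Fˣ} (hϖ : normAbs F (ϖ : F) = (residueFieldCard F : ℝ≥0)⁻¹)
    (a : Fˣ) (i : ℕ) {m : ℤ} (ha : normAbs F (a : F) = (residueFieldCard F : ℝ≥0)⁻¹ ^ m) :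
    normAbs F ((a * ϖ ^ i : Fˣ) : F) = (residueFieldCard F : ℝ≥0)⁻¹ ^ (m + i) := by
  rw [Units.val_mul, Units.val_pow_eq_pow_val, map_mul, map_pow, ha, hϖ, zpow_add₀
    inv_residueFieldCard_pos.ne', zpow_natCast]

/-- `|a (ϖ^i)⁻¹| = |a| q^{i}`. [folklore] -/
theorem normAbs_mul_pow_inv_eq {ϖ : Fˣ} (hϖ : normAbs F (ϖ : F) = (residueFieldCard F : ℝ≥0)⁻¹)
    (a : Fˣ) (i : ℕ) {m : ℤ} (ha : normAbs F (a : F) = (residueFieldCard F : ℝ≥0)⁻¹ ^ m) :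
    normAbs F ((a * (ϖ ^ i)⁻¹ : Fˣ) : F) = (residueFieldCard F : ℝ≥0)⁻¹ ^ (m - i) := by
  rw [Units.val_mul, Units.val_inv_eq_inv_val, Units.val_pow_eq_pow_val, map_mul, map_inv₀, map_pow,
    ha, hϖ, ← zpow_natCast, ← zpow_neg, ← zpow_add₀ inv_residueFieldCard_pos.ne', sub_eq_add_neg]

/-- **Exponential growth at `0` from a monic recursion.**  Let `Φ : Fˣ → ℂ` be continuous and
satisfy `∑_{i ≤ d} cᵢ Φ(a ϖⁱ) = 0` for `a ∈ 𝔭^k` with `c_d = 1` (`|ϖ| = q⁻¹`).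
Then `‖Φ(a)‖ ≤ C q^{N j}` on the shell `|a| = q^{-(k₁ + j)}` (`j ∈ ℕ`) for suitable `C ≥ 0`, `N`:
the finitely many shells `k₁ ≤ · < max k k₁ + d` are compact, and from there on the recursion
expresses `Φ` on a shell through its values on the `d` previous ones
(Jacquet–Langlands 1970, proof of Prop. 2.10; Godement 1970, §1.3). [cite: JacquetLanglands1970, Prop. 2.10] -/
theorem exists_norm_le_pow_of_recursion {Φ : Fˣ → ℂ} (hΦ : Continuous Φ) (k₁ : ℤ)
    {ϖ : Fˣ} (hϖ : normAbs F (ϖ : F) = (residueFieldCard F : ℝ≥0)⁻¹)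
    {d : ℕ} {c : ℕ → ℂ} (hcd : c d = 1) {k : ℤ}
    (hrec : ∀ a : Fˣ, (a : F) ∈ primePowBall F k → ∑ i ∈ Finset.range (d + 1), c i * Φ (a * ϖ ^ i) = 0) :
    ∃ (C : ℝ) (N : ℕ), 0 ≤ C ∧ ∀ (j : ℕ) (a : Fˣ),
      normAbs F (a : F) = (residueFieldCard F : ℝ≥0)⁻¹ ^ (k₁ + j) →
        ‖Φ a‖ ≤ C * (residueFieldCard F : ℝ) ^ (N * j) := by
  set r : ℝ≥0 := (residueFieldCard F : ℝ≥0)⁻¹ with hr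
  have hr0 : 0 < r := inv_residueFieldCard_pos
  have hq1 : (1 : ℝ) < (residueFieldCard F : ℝ) := by exact_mod_cast one_lt_residueFieldCard F
  -- the recursion on the smaller ball `𝔭^{k'}`, `k' = max k k₁`
  set k' : ℤ := max k k₁ with hk'
  have hrec' : ∀ a : Fˣ, (a : F) ∈ primePowBall F k' →
      ∑ i ∈ Finset.range (d + 1), c i * Φ (a * ϖ ^ i) = 0 := fun a ha =>
    hrec a (primePowBall_antitone (le_max_left _ _) ha)
  -- bounds on the shells
  have hB : ∀ j : ℕ, ∃ B : ℝ, ∀ a : Fˣ, normAbs F (a : F) = r ^ (k₁ + j) → ‖Φ a‖ ≤ B := fun j =>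
    (isCompact_shell (k₁ + j)).exists_bound_of_continuousOn hΦ.continuousOn
  choose B hB using hB
  set L : ℕ := (k' - k₁).toNat + d with hL
  set C₀ : ℝ := ∑ j ∈ Finset.range L, max (B j) 0 with hC₀
  have hC₀0 : 0 ≤ C₀ := Finset.sum_nonneg fun j _ => le_max_right _ _
  have hBC₀ : ∀ j < L, B j ≤ C₀ := fun j hj =>
    (le_max_left _ _).trans (Finset.single_le_sum (f := fun j => max (B j) 0)
      (fun j _ => le_max_right _ _) (Finset.mem_range.2 hj))
  -- `R = q^N ≥ ∑ ‖cᵢ‖`, `R ≥ 1`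
  obtain ⟨N, hN⟩ := pow_unbounded_of_one_lt (∑ i ∈ Finset.range d, ‖c i‖) hq1
  set R : ℝ := (residueFieldCard F : ℝ) ^ N with hR
  have hR1 : 1 ≤ R := one_le_pow₀ hq1.le
  have hR0 : 0 ≤ R := zero_le_one.trans hR1
  have hcR : ∑ i ∈ Finset.range d, ‖c i‖ ≤ R := hN.le
  refine ⟨C₀, N, hC₀0, fun j => ?_⟩
  -- strong induction on the shell index
  induction j using Nat.strong_induction_on with
  | _ j ih =>
    intro a ha
    rw [pow_mul, ← hR]
    by_cases hjL : j < L
    · calc ‖Φ a‖ ≤ B j := hB j a ha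
        _ ≤ C₀ := hBC₀ j hjL
        _ ≤ C₀ * R ^ j := le_mul_of_one_le_right hC₀0 (one_le_pow₀ hR1)
    · push Not at hjL
      rcases Nat.eq_zero_or_pos d with hd | hd
      · -- no recursion terms: `Φ a = 0` on `𝔭^{k'}`
        subst hd
        have hak' : (a : F) ∈ primePowBall F k' := by
          rw [mem_primePowBall_iff, ha, inv_residueFieldCard_zpow_le_iff]
          have : (k' - k₁).toNat ≤ (j : ℤ) := by exact_mod_cast hjL
          have h2 := Int.self_le_toNat (k' - k₁)
          omega
        have h := hrec' a hak'
        rw [Finset.sum_range_one, hcd, one_mul, pow_zero, mul_one] at h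
        rw [h, norm_zero]
        exact mul_nonneg hC₀0 (pow_nonneg hR0 _)
      · have hdj : d ≤ j := le_trans (Nat.le_add_left d _) hjL
        -- `a = a' ϖ^d` with `a' ∈ 𝔭^{k'}` on the shell `k₁ + (j - d)`
        set a' : Fˣ := a * (ϖ ^ d)⁻¹ with ha'
        have ha'n : normAbs F (a' : F) = r ^ (k₁ + ((j - d : ℕ) : ℤ)) := by
          rw [ha', normAbs_mul_pow_inv_eq hϖ a d ha, Nat.cast_sub hdj, hr]
          ring_nf
        have hak' : (a' : F) ∈ primePowBall F k' := by
          rw [mem_primePowBall_iff, ha'n, inv_residueFieldCard_zpow_le_iff]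
          have : (k' - k₁).toNat + d ≤ j := hjL
          have h2 := Int.self_le_toNat (k' - k₁)
          omega
        have h := hrec' a' hak'
        rw [Finset.sum_range_succ, hcd, one_mul, ha', inv_mul_cancel_right] at h
        have hΦa : Φ a = -∑ i ∈ Finset.range d, c i * Φ (a * (ϖ ^ d)⁻¹ * ϖ ^ i) :=
          eq_neg_of_add_eq_zero_right h
        -- the previous shells
        have hterm : ∀ i ∈ Finset.range d, ‖c i * Φ (a * (ϖ ^ d)⁻¹ * ϖ ^ i)‖ ≤ ‖c i‖ * (C₀ * R ^ (j - 1)) := by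
          intro i hi
          rw [Finset.mem_range] at hi
          rw [norm_mul]
          refine mul_le_mul_of_nonneg_left ?_ (norm_nonneg _)
          have hi' : normAbs F ((a * (ϖ ^ d)⁻¹ * ϖ ^ i : Fˣ) : F) = r ^ (k₁ + ((j - d + i : ℕ) : ℤ)) := by
            rw [← ha', normAbs_mul_pow_eq hϖ a' i ha'n, hr]
            push_cast
            ring_nf
          have hlt : j - d + i < j := by omega
          have hIH := ih (j - d + i) hlt _ hi'
          rw [pow_mul, ← hR] at hIH
          refine hIH.trans (mul_le_mul_of_nonneg_left (pow_le_pow_right₀ hR1 (by omega)) hC₀0)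
        calc ‖Φ a‖ = ‖∑ i ∈ Finset.range d, c i * Φ (a * (ϖ ^ d)⁻¹ * ϖ ^ i)‖ := by rw [hΦa, norm_neg]
          _ ≤ ∑ i ∈ Finset.range d, ‖c i * Φ (a * (ϖ ^ d)⁻¹ * ϖ ^ i)‖ := norm_sum_le _ _
          _ ≤ ∑ i ∈ Finset.range d, ‖c i‖ * (C₀ * R ^ (j - 1)) := Finset.sum_le_sum hterm
          _ = (∑ i ∈ Finset.range d, ‖c i‖) * (C₀ * R ^ (j - 1)) := by rw [← Finset.sum_mul]
          _ ≤ R * (C₀ * R ^ (j - 1)) :=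
              mul_le_mul_of_nonneg_right hcR (mul_nonneg hC₀0 (pow_nonneg hR0 _))
          _ = C₀ * R ^ j := by
              have hj1 : j - 1 + 1 = j := Nat.sub_add_cancel (le_trans hd hdj)
              conv_rhs => rw [← hj1, pow_succ]
              ring

/-- The bound of `exists_norm_le_pow_of_recursion` in the form `‖Φ(a)‖ ≤ C · 1_{𝔭^{k₁}}(a) |a|^{-N}`.
[cite: JacquetLanglands1970, Prop. 2.10] -/
theorem exists_norm_le_indicator_rpow_of_recursion {Φ : Fˣ → ℂ} (hΦ : Continuous Φ) {k₁ : ℤ}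
    (h0 : ∀ a : Fˣ, (a : F) ∉ primePowBall F k₁ → Φ a = 0)
    {ϖ : Fˣ} (hϖ : normAbs F (ϖ : F) = (residueFieldCard F : ℝ≥0)⁻¹)
    {d : ℕ} {c : ℕ → ℂ} (hcd : c d = 1) {k : ℤ}
    (hrec : ∀ a : Fˣ, (a : F) ∈ primePowBall F k → ∑ i ∈ Finset.range (d + 1), c i * Φ (a * ϖ ^ i) = 0) :
    ∃ (C : ℝ) (N : ℕ), ∀ a : Fˣ, ‖Φ a‖ ≤ C * {x : Fˣ | (x : F) ∈ primePowBall F k₁}.indicator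
        (fun x => ((normAbs F (x : F) : ℝ≥0) : ℝ) ^ (-(N : ℝ))) a := by
  obtain ⟨C, N, hC, hle⟩ := exists_norm_le_pow_of_recursion hΦ k₁ hϖ hcd hrec
  set q : ℝ := (residueFieldCard F : ℝ) with hq
  have hq0 : 0 < q := by rw [hq]; exact_mod_cast (one_lt_residueFieldCard F).le.trans_lt' zero_lt_one
  refine ⟨C * q ^ (-(k₁ * N)), N, fun a => ?_⟩
  by_cases ha : (a : F) ∈ primePowBall F k₁
  · rw [Set.indicator_of_mem (show a ∈ {x : Fˣ | (x : F) ∈ primePowBall F k₁} from ha)]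
    have hmem : a ∈ {x : Fˣ | (x : F) ∈ primePowBall F k₁} := ha
    rw [setOf_units_mem_primePowBall_eq_iUnion, Set.mem_iUnion] at hmem
    obtain ⟨j, hj⟩ := hmem
    have hj' : normAbs F (a : F) = (residueFieldCard F : ℝ≥0)⁻¹ ^ (k₁ + j) := hj
    refine (hle j a hj').trans (le_of_eq ?_)
    -- `q^{N j} = q^{-k₁ N} · |a|^{-N}` on the shell `|a| = q^{-(k₁ + j)}`
    have habs : ((normAbs F (a : F) : ℝ≥0) : ℝ) = q ^ (-(k₁ + j)) := by
      rw [hj', NNReal.coe_zpow, NNReal.coe_inv, NNReal.coe_natCast, inv_zpow', hq]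
    rw [habs, ← Real.rpow_intCast q (-(k₁ + j)), ← Real.rpow_mul hq0.le, ← Real.rpow_intCast q (-(k₁ * N)),
      ← Real.rpow_natCast q (N * j), mul_assoc, ← Real.rpow_add hq0]
    congr 2
    push_cast
    ring
  · rw [h0 a ha, norm_zero, Set.indicator_of_notMem (show a ∉ {x : Fˣ | (x : F) ∈ primePowBall F k₁} from ha),
      mul_zero]

variable [MeasurableSpace F] [BorelSpace F]

/-- **Absolute convergence of the torus zeta integral** `∫_{Fˣ} Φ(a) κ |a|^{s - 1/2} dμ'(a)` for
`re s > N + 1/2`, given `‖Φ(a)‖ ≤ C · 1_{𝔭^{k₁}}(a) |a|^{-N}` (`μ'` finite on compacts and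
left invariant): the comparison lemma of Tate's thesis (`integrable_units_of_norm_le`).
(Jacquet–Langlands 1970, Prop. 2.10: `∫ W(d(a,1)) |a|^{s-1/2} d^×a` converges for `re s` large.)
[cite: JacquetLanglands1970, Prop. 2.10] -/
theorem integrable_mul_cpow_of_norm_le (μ' : Measure Fˣ) [IsFiniteMeasureOnCompacts μ']
    [μ'.IsMulLeftInvariant] {Φ : Fˣ → ℂ} (hΦ : Continuous Φ) {k₁ : ℤ} {C : ℝ} {N : ℕ}
    (hle : ∀ a : Fˣ, ‖Φ a‖ ≤ C * {x : Fˣ | (x : F) ∈ primePowBall F k₁}.indicator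
        (fun x => ((normAbs F (x : F) : ℝ≥0) : ℝ) ^ (-(N : ℝ))) a)
    (κ : ℂ) {s : ℂ} (hs : (N : ℝ) + 1 / 2 < s.re) :
    Integrable (fun a : Fˣ => Φ a * κ * (((normAbs F (a : F) : ℝ≥0) : ℝ) : ℂ) ^ (s - 1 / 2)) μ' := by
  haveI : BorelSpace Fˣ := Units.borelSpace
  have hcont : Continuous fun a : Fˣ => Φ a * κ * (((normAbs F (a : F) : ℝ≥0) : ℝ) : ℂ) ^ (s - 1 / 2) :=
    (hΦ.mul continuous_const).mul ((isLocallyConstant_normAbs_units (F := F)).comp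
      fun r : ℝ≥0 => ((r : ℝ) : ℂ) ^ (s - 1 / 2)).continuous
  refine integrable_units_of_norm_le μ' hcont.aestronglyMeasurable k₁ (t := s.re - 1 / 2 - N)
    (by linarith) (C * ‖κ‖) fun a => ?_
  have hpos : (0 : ℝ) < ((normAbs F (a : F) : ℝ≥0) : ℝ) := by exact_mod_cast normAbs_units_pos a
  rw [norm_mul, norm_mul, Complex.norm_cpow_eq_rpow_re_of_pos hpos, Complex.sub_re,
    show ((1 : ℂ) / 2).re = 1 / 2 by norm_num]
  by_cases ha : a ∈ {x : Fˣ | (x : F) ∈ primePowBall F k₁}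
  · have h1 := hle a
    rw [Set.indicator_of_mem ha] at h1 ⊢
    calc ‖Φ a‖ * ‖κ‖ * ((normAbs F (a : F) : ℝ≥0) : ℝ) ^ (s.re - 1 / 2)
        ≤ C * ((normAbs F (a : F) : ℝ≥0) : ℝ) ^ (-(N : ℝ)) * ‖κ‖ *
            ((normAbs F (a : F) : ℝ≥0) : ℝ) ^ (s.re - 1 / 2) := by gcongr
      _ = C * ‖κ‖ * ((normAbs F (a : F) : ℝ≥0) : ℝ) ^ (s.re - 1 / 2 - N) := by
          rw [show s.re - 1 / 2 - N = -(N : ℝ) + (s.re - 1 / 2) by ring, Real.rpow_add hpos]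
          ring
  · have h1 := hle a
    rw [Set.indicator_of_notMem ha, mul_zero] at h1 ⊢
    have h2 : ‖Φ a‖ = 0 := le_antisymm h1 (norm_nonneg _)
    rw [h2, zero_mul, zero_mul]

end Growth

/-! ### Part 4: rationality of the torus zeta integral with controlled denominator -/

section Rationality

variable {F : Type*} [Field F] [ValuativeRel F] [TopologicalSpace F] [IsNonarchimedeanLocalField F]

/-- `((x ^ m : ℝ) : ℂ) ^ c = ((x : ℂ) ^ c) ^ m` for `x > 0` and `m ∈ ℤ` (positive real bases have no
branch problem). [folklore] -/
theorem ofReal_zpow_cpow {x : ℝ} (hx : 0 < x) (m : ℤ) (c : ℂ) :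
    (((x ^ m : ℝ)) : ℂ) ^ c = ((x : ℂ) ^ c) ^ m := by
  rcases m with n | n
  · rw [Int.ofNat_eq_natCast, zpow_natCast, zpow_natCast, ofReal_pow_cpow hx.le]
  · rw [zpow_negSucc, zpow_negSucc, Complex.ofReal_inv, Complex.inv_cpow _ _ ?_, ofReal_pow_cpow hx.le]
    rw [Complex.arg_ofReal_of_nonneg (pow_nonneg hx.le _)]
    exact Real.pi_ne_zero.symm

/-- `|ϖ^i|^c`-bookkeeping: `((|a ϖ^i| : ℝ) : ℂ)^c = (|a| : ℂ)^c · ((q⁻¹ : ℂ)^c)^i`. [folklore] -/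
theorem normAbs_mul_pow_cpow {ϖ : Fˣ} (hϖ : normAbs F (ϖ : F) = (residueFieldCard F : ℝ≥0)⁻¹)
    (a : Fˣ) (i : ℕ) (c : ℂ) :
    (((normAbs F ((a * ϖ ^ i : Fˣ) : F) : ℝ≥0) : ℝ) : ℂ) ^ c =
      (((normAbs F (a : F) : ℝ≥0) : ℝ) : ℂ) ^ c *
        (((((residueFieldCard F : ℝ≥0)⁻¹ : ℝ≥0) : ℝ) : ℂ) ^ c) ^ i := by
  rw [Units.val_mul, Units.val_pow_eq_pow_val, map_mul, map_pow, hϖ, NNReal.coe_mul, NNReal.coe_pow,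
    Complex.ofReal_mul, Complex.mul_cpow_ofReal_nonneg (NNReal.coe_nonneg _) (pow_nonneg (NNReal.coe_nonneg _) _),
    ofReal_pow_cpow (NNReal.coe_nonneg _)]

variable [MeasurableSpace F] [BorelSpace F]

/-- **Integral of a function supported on finitely many shells.**  If `G : Fˣ → ℂ` is continuous
and vanishes off the shells `|a| = q^{-(k₀ + j)}`, `j < L`, then for a measure finite on compacts
`∫ G(a) κ |a|^c dμ'(a) = ∑_{j < L} (κ ∫_{|a| = q^{-(k₀+j)}} G dμ') · ((q⁻¹)^c)^{k₀ + j}` — a Laurent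
polynomial in `Y = (q⁻¹)^c` (Tate 1950, §2.5: integrate shell by shell). [cite: Tate1950, §2.5] -/
theorem integral_mul_cpow_eq_sum_of_shell_support (μ' : Measure Fˣ) [IsFiniteMeasureOnCompacts μ']
    {G : Fˣ → ℂ} (hG : Continuous G) (k₀ : ℤ) (L : ℕ)
    (hsupp : ∀ a : Fˣ, G a ≠ 0 → ∃ j : ℕ, j < L ∧
      normAbs F (a : F) = (residueFieldCard F : ℝ≥0)⁻¹ ^ (k₀ + j))
    (κ c : ℂ) :
    (∫ a, G a * κ * (((normAbs F (a : F) : ℝ≥0) : ℝ) : ℂ) ^ c ∂μ') =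
      ∑ j ∈ Finset.range L,
        (κ * ∫ a in {x : Fˣ | normAbs F (x : F) = (residueFieldCard F : ℝ≥0)⁻¹ ^ (k₀ + j)}, G a ∂μ') *
          (((((residueFieldCard F : ℝ≥0)⁻¹ : ℝ≥0) : ℝ) : ℂ) ^ c) ^ (k₀ + j : ℤ) := by
  haveI : BorelSpace Fˣ := Units.borelSpace
  set r : ℝ≥0 := (residueFieldCard F : ℝ≥0)⁻¹ with hr
  have hr0 : (0 : ℝ) < r := by rw [hr]; exact_mod_cast inv_residueFieldCard_pos (F := F)
  set Y : ℂ := (((r : ℝ≥0) : ℝ) : ℂ) ^ c with hY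
  set S : ℕ → Set Fˣ := fun j => {x : Fˣ | normAbs F (x : F) = r ^ (k₀ + j)} with hS
  have hSm : ∀ j, MeasurableSet (S j) := fun j => measurableSet_normAbs_shell _
  have hdisj : ∀ j j' : ℕ, j ≠ j' → Disjoint (S j) (S j') := fun j j' h =>
    pairwise_disjoint_shell (F := F) (show k₀ + (j : ℤ) ≠ k₀ + j' by omega)
  -- the pointwise decomposition along the shells
  have hpt : ∀ a : Fˣ, G a * κ * (((normAbs F (a : F) : ℝ≥0) : ℝ) : ℂ) ^ c =
      ∑ j ∈ Finset.range L, (S j).indicator (fun a => G a * κ * Y ^ (k₀ + j : ℤ)) a := by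
    intro a
    by_cases hGa : G a = 0
    · rw [hGa, zero_mul, zero_mul]
      symm
      refine Finset.sum_eq_zero fun j _ => ?_
      by_cases ha : a ∈ S j
      · rw [Set.indicator_of_mem ha, hGa, zero_mul, zero_mul]
      · rw [Set.indicator_of_notMem ha]
    · obtain ⟨j, hjL, hja⟩ := hsupp a hGa
      have haj : a ∈ S j := hja
      rw [Finset.sum_eq_single_of_mem j (Finset.mem_range.2 hjL) fun j' _ hj' =>
        Set.indicator_of_notMem (fun h => Set.disjoint_left.1 (hdisj j j' (Ne.symm hj')) haj h) _,
        Set.indicator_of_mem haj]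
      congr 1
      rw [hja, NNReal.coe_zpow, ofReal_zpow_cpow hr0]
  have hfun : (fun a : Fˣ => G a * κ * (((normAbs F (a : F) : ℝ≥0) : ℝ) : ℂ) ^ c) =
      fun a => ∑ j ∈ Finset.range L, (S j).indicator (fun a => G a * κ * Y ^ (k₀ + j : ℤ)) a :=
    funext hpt
  have hint : ∀ j, Integrable ((S j).indicator fun a => G a * κ * Y ^ (k₀ + j : ℤ)) μ' := by
    intro j
    refine IntegrableOn.integrable_indicator ?_ (hSm j)
    exact ((hG.mul continuous_const).mul continuous_const).continuousOn.integrableOn_compact'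
      (isCompact_shell _) (hSm j)
  rw [hfun, integral_finsetSum _ fun j _ => hint j]
  refine Finset.sum_congr rfl fun j _ => ?_
  rw [integral_indicator (hSm j), integral_mul_const, integral_mul_const]
  ring

/-- **Rationality with controlled denominator** (the heart of Jacquet–Langlands 1970, Prop. 2.10 /
Godement 1970, §1.3, Lemma 5, in integrated form).  Let `Φ : Fˣ → ℂ` be continuous, vanish off
`𝔭^{k₁}` and satisfy the monic recursion `∑_{i ≤ d} cᵢ Φ(a ϖⁱ) = 0` on `𝔭^k` (`c_d = 1`,
`|ϖ| = q⁻¹`).  Then for `μ'` left invariant and finite on compacts and `re s` large,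
`Q̃(Y) · ∫ Φ(a) κ |a|^{s-1/2} dμ'(a) = ∑_{j<L} e_j Y^{k₁ + j}` with `Y = (q⁻¹)^{s - 1/2} = q^{1/2} q^{-s}`
and `Q̃(Y) = ∑ᵢ cᵢ Y^{d-i}` the REVERSED recursion polynomial (constant term `c_d = 1`): substituting
`a ↦ a ϖⁱ` gives `Y^{d-i} ∫ Φ κ |·|^{s-1/2} = Y^d ∫ Φ(a ϖⁱ) κ |a|^{s-1/2}`, and
`G = ∑ cᵢ Φ(· ϖⁱ)` is supported on the finitely many shells `k₁ - d ≤ · < k`.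
[cite: JacquetLanglands1970, Prop. 2.10] -/
theorem exists_sum_mul_integral_eq_sum (μ' : Measure Fˣ) [IsFiniteMeasureOnCompacts μ']
    [μ'.IsMulLeftInvariant] {Φ : Fˣ → ℂ} (hΦ : Continuous Φ) {k₁ : ℤ}
    (h0 : ∀ a : Fˣ, (a : F) ∉ primePowBall F k₁ → Φ a = 0)
    {ϖ : Fˣ} (hϖ : normAbs F (ϖ : F) = (residueFieldCard F : ℝ≥0)⁻¹)
    {d : ℕ} {c : ℕ → ℂ} (hcd : c d = 1) {k : ℤ}
    (hrec : ∀ a : Fˣ, (a : F) ∈ primePowBall F k → ∑ i ∈ Finset.range (d + 1), c i * Φ (a * ϖ ^ i) = 0)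
    (κ : ℂ) :
    ∃ (L : ℕ) (e : ℕ → ℂ) (σ₀ : ℝ), ∀ s : ℂ, σ₀ < s.re →
      (∑ i ∈ Finset.range (d + 1),
          c i * (((((residueFieldCard F : ℝ≥0)⁻¹ : ℝ≥0) : ℝ) : ℂ) ^ (s - 1 / 2)) ^ (d - i)) *
        (∫ a, Φ a * κ * (((normAbs F (a : F) : ℝ≥0) : ℝ) : ℂ) ^ (s - 1 / 2) ∂μ') =
      ∑ j ∈ Finset.range L,
        e j * (((((residueFieldCard F : ℝ≥0)⁻¹ : ℝ≥0) : ℝ) : ℂ) ^ (s - 1 / 2)) ^ (k₁ + j : ℤ) := by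
  haveI : BorelSpace Fˣ := Units.borelSpace
  set r : ℝ≥0 := (residueFieldCard F : ℝ≥0)⁻¹ with hr
  have hr0 : (0 : ℝ) < r := by rw [hr]; exact_mod_cast inv_residueFieldCard_pos (F := F)
  obtain ⟨C, N, hle⟩ := exists_norm_le_indicator_rpow_of_recursion hΦ h0 hϖ hcd hrec
  -- the function `G = ∑ cᵢ Φ(· ϖⁱ)` and its support
  set G : Fˣ → ℂ := fun a => ∑ i ∈ Finset.range (d + 1), c i * Φ (a * ϖ ^ i) with hG
  have hGc : Continuous G := by
    refine continuous_finsetSum _ fun i _ => continuous_const.mul (hΦ.comp (continuous_mul_const _))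
  set k₀ : ℤ := k₁ - d with hk₀
  set L : ℕ := (k - k₀).toNat with hL
  have hsupp : ∀ a : Fˣ, G a ≠ 0 → ∃ j : ℕ, j < L ∧ normAbs F (a : F) = r ^ (k₀ + j) := by
    intro a hGa
    obtain ⟨m, hm⟩ := exists_normAbs_eq_inv_zpow (F := F) a.ne_zero
    -- `a ∉ 𝔭^k`
    have hk' : m < k := by
      by_contra hmk
      push Not at hmk
      exact hGa (hrec a (by rw [mem_primePowBall_iff, hm, inv_residueFieldCard_zpow_le_iff]; exact hmk))
    -- `a ∈ 𝔭^{k₁ - d}`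
    obtain ⟨i, hi, hia⟩ := Finset.exists_ne_zero_of_sum_ne_zero hGa
    have hΦi : Φ (a * ϖ ^ i) ≠ 0 := fun h => hia (by rw [h, mul_zero])
    have hmem : ((a * ϖ ^ i : Fˣ) : F) ∈ primePowBall F k₁ := by
      by_contra h
      exact hΦi (h0 _ h)
    rw [mem_primePowBall_iff, normAbs_mul_pow_eq hϖ a i hm, inv_residueFieldCard_zpow_le_iff] at hmem
    rw [Finset.mem_range] at hi
    have hk₀m : k₀ ≤ m := by omega
    refine ⟨(m - k₀).toNat, ?_, ?_⟩
    · rw [hL]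
      exact (Int.toNat_lt_toNat (by omega)).2 (by omega)
    · rw [hm, Int.toNat_of_nonneg (sub_nonneg.2 hk₀m), add_sub_cancel]
  refine ⟨L, fun j => κ * ∫ a in {x : Fˣ | normAbs F (x : F) = r ^ (k₀ + j)}, G a ∂μ', (N : ℝ) + 1 / 2,
    fun s hs => ?_⟩
  set Y : ℂ := (((r : ℝ≥0) : ℝ) : ℂ) ^ (s - 1 / 2) with hY
  have hY0 : Y ≠ 0 := by
    rw [hY, Ne, Complex.cpow_eq_zero_iff, not_and_or]
    exact Or.inl (Complex.ofReal_ne_zero.2 hr0.ne')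
  set f : Fˣ → ℂ := fun a => Φ a * κ * (((normAbs F (a : F) : ℝ≥0) : ℝ) : ℂ) ^ (s - 1 / 2) with hf
  have hfi : Integrable f μ' := integrable_mul_cpow_of_norm_le μ' hΦ hle κ hs
  -- substitution `a ↦ a ϖⁱ`: `∫ f = Y^i ∫ Φ(a ϖⁱ) κ |a|^{s-1/2}`
  have hsub : ∀ i : ℕ, (∫ a, f a ∂μ') =
      (∫ a, Φ (a * ϖ ^ i) * κ * (((normAbs F (a : F) : ℝ≥0) : ℝ) : ℂ) ^ (s - 1 / 2) ∂μ') * Y ^ i := by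
    intro i
    rw [← integral_mul_right_eq_self f (ϖ ^ i), ← integral_mul_const]
    refine integral_congr_ae (Eventually.of_forall fun a => ?_)
    simp only [hf]
    rw [normAbs_mul_pow_cpow hϖ a i]
    ring
  -- integrability of the substituted functions
  have hfi' : ∀ i : ℕ, Integrable
      (fun a : Fˣ => Φ (a * ϖ ^ i) * κ * (((normAbs F (a : F) : ℝ≥0) : ℝ) : ℂ) ^ (s - 1 / 2)) μ' := by
    intro i
    have h := (hfi.comp_mul_right (ϖ ^ i)).mul_const ((Y ^ i)⁻¹)
    refine h.congr (Eventually.of_forall fun a => ?_)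
    simp only [hf]
    rw [normAbs_mul_pow_cpow hϖ a i, mul_assoc, mul_assoc, mul_assoc, mul_inv_cancel₀ (pow_ne_zero _ hY0),
      mul_one, mul_assoc]
  -- `∫ G κ |·|^{s-1/2} = ∑ cᵢ ∫ Φ(a ϖⁱ) κ |a|^{s-1/2}`
  have hGint : (∫ a, G a * κ * (((normAbs F (a : F) : ℝ≥0) : ℝ) : ℂ) ^ (s - 1 / 2) ∂μ') =
      ∑ i ∈ Finset.range (d + 1),
        c i * ∫ a, Φ (a * ϖ ^ i) * κ * (((normAbs F (a : F) : ℝ≥0) : ℝ) : ℂ) ^ (s - 1 / 2) ∂μ' := by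
    have hG' : (fun a : Fˣ => G a * κ * (((normAbs F (a : F) : ℝ≥0) : ℝ) : ℂ) ^ (s - 1 / 2)) =
        fun a => ∑ i ∈ Finset.range (d + 1),
          c i * (Φ (a * ϖ ^ i) * κ * (((normAbs F (a : F) : ℝ≥0) : ℝ) : ℂ) ^ (s - 1 / 2)) := by
      funext a
      simp only [hG, Finset.sum_mul]
      refine Finset.sum_congr rfl fun i _ => ?_
      ring
    rw [hG', integral_finsetSum _ fun i _ => (hfi' i).const_mul (c i)]
    refine Finset.sum_congr rfl fun i _ => ?_
    exact integral_const_mul _ _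
  -- assemble
  have hshell := integral_mul_cpow_eq_sum_of_shell_support μ' hGc k₀ L hsupp κ (s - 1 / 2)
  rw [← hr] at hshell
  calc (∑ i ∈ Finset.range (d + 1), c i * Y ^ (d - i)) * (∫ a, f a ∂μ')
      = ∑ i ∈ Finset.range (d + 1), c i * (Y ^ (d - i) * ∫ a, f a ∂μ') := by
        rw [Finset.sum_mul]
        refine Finset.sum_congr rfl fun i _ => ?_
        ring
    _ = ∑ i ∈ Finset.range (d + 1), c i * (Y ^ d *
          ∫ a, Φ (a * ϖ ^ i) * κ * (((normAbs F (a : F) : ℝ≥0) : ℝ) : ℂ) ^ (s - 1 / 2) ∂μ') := by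
        refine Finset.sum_congr rfl fun i hi => ?_
        rw [Finset.mem_range] at hi
        rw [hsub i]
        have : Y ^ (d - i) * Y ^ i = Y ^ d := by rw [← pow_add, Nat.sub_add_cancel (by omega)]
        rw [← this]
        ring
    _ = Y ^ d * ∫ a, G a * κ * (((normAbs F (a : F) : ℝ≥0) : ℝ) : ℂ) ^ (s - 1 / 2) ∂μ' := by
        rw [hGint, Finset.mul_sum]
        refine Finset.sum_congr rfl fun i _ => ?_
        ring
    _ = ∑ j ∈ Finset.range L, (κ * ∫ a in {x : Fˣ | normAbs F (x : F) = r ^ (k₀ + j)}, G a ∂μ') *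
          Y ^ (k₁ + j : ℤ) := by
        rw [hshell, Finset.mul_sum]
        refine Finset.sum_congr rfl fun j _ => ?_
        have hexp : Y ^ (k₁ + j : ℤ) = Y ^ (k₀ + j : ℤ) * Y ^ d := by
          rw [← zpow_natCast Y d, ← zpow_add₀ hY0]
          congr 1
          rw [hk₀]
          ring
        rw [hexp]
        ring

/-- `exists_sum_mul_integral_eq_sum` cleared of negative powers: `Y^K Q̃(Y) ∫ Φ κ |·|^{s-1/2} = p(Y)`
for a polynomial `p` and `K ∈ ℕ`. [cite: JacquetLanglands1970, Prop. 2.10] -/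
theorem exists_pow_mul_sum_mul_integral_eq_eval (μ' : Measure Fˣ) [IsFiniteMeasureOnCompacts μ']
    [μ'.IsMulLeftInvariant] {Φ : Fˣ → ℂ} (hΦ : Continuous Φ) {k₁ : ℤ}
    (h0 : ∀ a : Fˣ, (a : F) ∉ primePowBall F k₁ → Φ a = 0)
    {ϖ : Fˣ} (hϖ : normAbs F (ϖ : F) = (residueFieldCard F : ℝ≥0)⁻¹)
    {d : ℕ} {c : ℕ → ℂ} (hcd : c d = 1) {k : ℤ}
    (hrec : ∀ a : Fˣ, (a : F) ∈ primePowBall F k → ∑ i ∈ Finset.range (d + 1), c i * Φ (a * ϖ ^ i) = 0)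
    (κ : ℂ) :
    ∃ (K : ℕ) (p : ℂ[X]) (σ₀ : ℝ), ∀ s : ℂ, σ₀ < s.re →
      (((((residueFieldCard F : ℝ≥0)⁻¹ : ℝ≥0) : ℝ) : ℂ) ^ (s - 1 / 2)) ^ K *
        (∑ i ∈ Finset.range (d + 1),
          c i * (((((residueFieldCard F : ℝ≥0)⁻¹ : ℝ≥0) : ℝ) : ℂ) ^ (s - 1 / 2)) ^ (d - i)) *
        (∫ a, Φ a * κ * (((normAbs F (a : F) : ℝ≥0) : ℝ) : ℂ) ^ (s - 1 / 2) ∂μ') =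
      p.eval (((((residueFieldCard F : ℝ≥0)⁻¹ : ℝ≥0) : ℝ) : ℂ) ^ (s - 1 / 2)) := by
  obtain ⟨L, e, σ₀, h⟩ := exists_sum_mul_integral_eq_sum μ' hΦ h0 hϖ hcd hrec κ
  have hr0 : (0 : ℝ) < (((residueFieldCard F : ℝ≥0)⁻¹ : ℝ≥0) : ℝ) := by
    exact_mod_cast inv_residueFieldCard_pos (F := F)
  set K : ℕ := (-k₁).toNat with hK
  refine ⟨K, ∑ j ∈ Finset.range L, Polynomial.C (e j) * X ^ ((k₁ + K).toNat + j), σ₀, fun s hs => ?_⟩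
  set Y : ℂ := (((((residueFieldCard F : ℝ≥0)⁻¹ : ℝ≥0) : ℝ) : ℂ) ^ (s - 1 / 2)) with hY
  have hY0 : Y ≠ 0 := by
    rw [hY, Ne, Complex.cpow_eq_zero_iff, not_and_or]
    exact Or.inl (Complex.ofReal_ne_zero.2 hr0.ne')
  rw [mul_assoc, h s hs, Finset.mul_sum, Polynomial.eval_finsetSum]
  refine Finset.sum_congr rfl fun j _ => ?_
  rw [Polynomial.eval_mul, Polynomial.eval_C, Polynomial.eval_pow, Polynomial.eval_X, ← hY]
  have hk : 0 ≤ k₁ + K := by rw [hK]; have := Int.self_le_toNat (-k₁); omega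
  have hpow : Y ^ ((k₁ + K).toNat + j) = Y ^ K * Y ^ (k₁ + j : ℤ) := by
    rw [← zpow_natCast, ← zpow_natCast Y K, ← zpow_add₀ hY0]
    congr 1
    push_cast
    rw [Int.toNat_of_nonneg hk]
    ring
  rw [hpow]
  ring

end Rationality

/-! ### Part 5: comparison with clause (b) of `HasRSLFactor`; the divisibility `P ∣ X^n D` -/

section Comparison

/-- `(1/P)(t) · P(t) = 1` at a non-root `t` of `P` (`RatFunc.eval` off the poles). [folklore] -/
theorem eval_rsLRat_mul_eval {P : ℂ[X]} (hP : P ≠ 0) {t : ℂ} (ht : P.eval t ≠ 0) :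
    (rsLRat P).eval (RingHom.id ℂ) t * P.eval t = 1 := by
  have hinj := IsFractionRing.injective ℂ[X] (RatFunc ℂ)
  have h1 : rsLRat P * algebraMap ℂ[X] (RatFunc ℂ) P = 1 :=
    inv_mul_cancel₀ ((map_ne_zero_iff _ hinj).mpr hP)
  have hden : (rsLRat P).denom ∣ P := by
    have : rsLRat P = algebraMap ℂ[X] (RatFunc ℂ) 1 / algebraMap ℂ[X] (RatFunc ℂ) P := by
      rw [rsLRat, map_one, one_div]
    rw [this]
    exact RatFunc.denom_div_dvd 1 P
  have hx : Polynomial.eval₂ (RingHom.id ℂ) t (rsLRat P).denom ≠ 0 := by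
    rw [Polynomial.eval₂_id]
    intro h0
    obtain ⟨r, hr⟩ := hden
    exact ht (by rw [hr, Polynomial.eval_mul, h0, zero_mul])
  have hy : Polynomial.eval₂ (RingHom.id ℂ) t (algebraMap ℂ[X] (RatFunc ℂ) P).denom ≠ 0 := by
    rw [RatFunc.denom_algebraMap, Polynomial.eval₂_one]
    exact one_ne_zero
  have h2 := congrArg (RatFunc.eval (RingHom.id ℂ) t) h1
  rwa [RatFunc.eval_mul (RingHom.id ℂ) t hx hy, RatFunc.eval_one, RatFunc.eval_algebraMap,
    Polynomial.eval₂_id] at h2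

/-- **The comparison with clause (b).**  Suppose `∑ᵢ Qᵢ(q^{-s}) Zᵢ(s) = 1/P(q^{-s})` on a right
half-plane with `Qᵢ` Laurent polynomials (clause (b) of `HasRSLFactor`: `1/P` lies in the
`ℂ[q^{∓s}]`-span of the zeta integrals `Zᵢ`), and each `Zᵢ` satisfies
`X^{Kᵢ} D(X) Zᵢ(s) = pᵢ(X)` at `X = q^{-s}` on a right half-plane, for polynomials `pᵢ` and one
COMMON polynomial `D`.  Then `X^n D = a P` for some polynomial `a` and `n ∈ ℕ`: evaluate at the
points `X = q^{-j}`, `j ∈ ℕ` large (off the roots of `P`), clear denominators and compare the two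
polynomials at infinitely many points.  This is the argument of
`HasRSLFactor.exists_X_pow_mul_eq` with clause (a) replaced by the explicit relations
(Jacquet–Piatetski-Shapiro–Shalika 1983, Thm. 2.7 (ii); Cogdell, Thm. 3.1).
[cite: JacquetPiatetskiShapiroShalika1983, Thm. 2.7 (ii)] -/
theorem exists_X_pow_mul_eq_of_relations {q : ℕ} (hq : 1 < q) {P : ℂ[X]} (hP : P ≠ 0)
    {ι : Type*} [Fintype ι] (Z : ι → ℂ → ℂ) (Qr : ι → RatFunc ℂ) (hQ : ∀ i, IsLaurent (Qr i))
    {c₀ : ℝ} (hb : ∀ s : ℂ, c₀ < s.re → ∑ i, evalAtQ q (Qr i) s * Z i s = evalAtQ q (rsLRat P) s)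
    (D : ℂ[X]) (hrel : ∀ i, ∃ (K : ℕ) (p : ℂ[X]) (σ : ℝ), ∀ s : ℂ, σ < s.re →
      ((q : ℂ) ^ (-s)) ^ K * D.eval ((q : ℂ) ^ (-s)) * Z i s = p.eval ((q : ℂ) ^ (-s))) :
    ∃ (a : ℂ[X]) (n : ℕ), (X : ℂ[X]) ^ n * D = a * P := by
  classical
  choose K p σ hrel using hrel
  choose A e hAe using hQ
  set Kmax : ℕ := Finset.univ.sup K with hKmax
  set emax : ℕ := Finset.univ.sup e with hemax
  have hKle : ∀ i, K i ≤ Kmax := fun i => Finset.le_sup (Finset.mem_univ i)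
  have hele : ∀ i, e i ≤ emax := fun i => Finset.le_sup (Finset.mem_univ i)
  obtain ⟨N₀, hN₀⟩ := exists_forall_lt_re_and_eval_ne_zero hq (Sum.elim (fun _ : Unit => c₀) σ)
    (fun _ : Unit => P) (fun _ => hP)
  set t : ℕ → ℂ := fun j => ((q : ℂ) ^ j)⁻¹ with ht
  have hq0 : (q : ℂ) ≠ 0 := Nat.cast_ne_zero.2 (by omega)
  have ht0 : ∀ j, t j ≠ 0 := fun j => inv_ne_zero (pow_ne_zero _ hq0)
  -- the polynomial `N = ∑ Aᵢ X^{emax - eᵢ} X^{Kmax - Kᵢ} pᵢ`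
  set N : ℂ[X] := ∑ i, A i * X ^ (emax - e i) * X ^ (Kmax - K i) * p i with hN
  have key : ∀ j : ℕ, N₀ ≤ j → (N * P).eval (t j) = ((X : ℂ[X]) ^ (emax + Kmax) * D).eval (t j) := by
    intro j hj
    obtain ⟨hre, hroot⟩ := hN₀ j hj
    have hc₀ : c₀ < ((j : ℂ)).re := hre (Sum.inl ())
    have hPt : P.eval (t j) ≠ 0 := hroot ()
    have hqs : (q : ℂ) ^ (-(j : ℂ)) = t j := by rw [ht, Complex.cpow_neg, Complex.cpow_natCast]
    -- clause (b) at `s = j`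
    have hbj := hb (j : ℂ) hc₀
    simp only [evalAtQ_natCast] at hbj
    -- the relations at `s = j`
    have hrelj : ∀ i, (t j) ^ K i * D.eval (t j) * Z i j = (p i).eval (t j) := fun i => by
      have h := hrel i (j : ℂ) (hre (Sum.inr i))
      rwa [hqs] at h
    -- `Aᵢ(t) = Qᵢ(t) t^{eᵢ}`
    have hA : ∀ i, (A i).eval (t j) = (Qr i).eval (RingHom.id ℂ) (t j) * (t j) ^ e i := fun i => by
      rw [hAe i, ratFunc_eval_laurent_mul_pow (A i) (e i) (ht0 j)]
    have h1 : (rsLRat P).eval (RingHom.id ℂ) (t j) * P.eval (t j) = 1 := eval_rsLRat_mul_eval hP hPt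
    rw [Polynomial.eval_mul, hN, Polynomial.eval_finsetSum, Polynomial.eval_mul, Polynomial.eval_pow,
      Polynomial.eval_X]
    have hterm : ∀ i, (A i * X ^ (emax - e i) * X ^ (Kmax - K i) * p i).eval (t j) =
        (Qr i).eval (RingHom.id ℂ) (t j) * Z i j * ((t j) ^ emax * (t j) ^ Kmax * D.eval (t j)) := by
      intro i
      simp only [Polynomial.eval_mul, Polynomial.eval_pow, Polynomial.eval_X]
      rw [hA i, ← hrelj i]
      have he : (t j) ^ e i * (t j) ^ (emax - e i) = (t j) ^ emax := by
        rw [← pow_add, Nat.add_sub_cancel' (hele i)]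
      have hK : (t j) ^ (Kmax - K i) * (t j) ^ K i = (t j) ^ Kmax := by
        rw [← pow_add, Nat.sub_add_cancel (hKle i)]
      calc (Qr i).eval (RingHom.id ℂ) (t j) * t j ^ e i * t j ^ (emax - e i) * t j ^ (Kmax - K i) *
            (t j ^ K i * D.eval (t j) * Z i j)
          = (Qr i).eval (RingHom.id ℂ) (t j) * Z i j * ((t j ^ e i * t j ^ (emax - e i)) *
              (t j ^ (Kmax - K i) * t j ^ K i) * D.eval (t j)) := by ring
        _ = _ := by rw [he, hK]
    rw [Finset.sum_congr rfl fun i _ => hterm i, ← Finset.sum_mul, hbj, pow_add]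
    calc (rsLRat P).eval (RingHom.id ℂ) (t j) * (t j ^ emax * t j ^ Kmax * D.eval (t j)) * P.eval (t j)
        = ((rsLRat P).eval (RingHom.id ℂ) (t j) * P.eval (t j)) * (t j ^ emax * t j ^ Kmax * D.eval (t j)) := by
          ring
      _ = t j ^ emax * t j ^ Kmax * D.eval (t j) := by rw [h1, one_mul]
  -- two polynomials agreeing at infinitely many points
  have hinf : Set.Infinite {x : ℂ | (N * P).eval x = ((X : ℂ[X]) ^ (emax + Kmax) * D).eval x} := by
    refine ((Set.Ici_infinite N₀).image (inv_natCast_pow_injective hq).injOn).mono ?_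
    rintro _ ⟨j, hj, rfl⟩
    exact key j hj
  have hpoly := Polynomial.eq_of_infinite_eval_eq _ _ hinf
  exact ⟨N, emax + Kmax, by rw [← hpoly, mul_comm]⟩

/-- If `X^n D = a P` with `P(0) ≠ 0` and `D ≠ 0`, then `deg P ≤ deg D` (`P` is prime to `X`, so
`P ∣ D`). [folklore] -/
theorem natDegree_le_of_X_pow_mul_eq {P D a : ℂ[X]} {n : ℕ} (hP0 : P.eval 0 ≠ 0) (hD : D ≠ 0)
    (h : (X : ℂ[X]) ^ n * D = a * P) : P.natDegree ≤ D.natDegree := by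
  have hcop : IsCoprime P (X : ℂ[X]) := by
    refine ⟨Polynomial.C (P.coeff 0)⁻¹, -(Polynomial.C (P.coeff 0)⁻¹ * P.divX), ?_⟩
    have h0 : P.coeff 0 ≠ 0 := by rwa [Polynomial.coeff_zero_eq_eval_zero]
    have hP := Polynomial.X_mul_divX_add P
    calc Polynomial.C (P.coeff 0)⁻¹ * P + -(Polynomial.C (P.coeff 0)⁻¹ * P.divX) * X
        = Polynomial.C (P.coeff 0)⁻¹ * (P - X * P.divX) := by ring
      _ = Polynomial.C (P.coeff 0)⁻¹ * Polynomial.C (P.coeff 0) := by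
          congr 1
          rw [sub_eq_iff_eq_add, add_comm, hP]
      _ = 1 := by rw [← Polynomial.C_mul, inv_mul_cancel₀ h0, Polynomial.C_1]
  have hdvd : P ∣ D * (X : ℂ[X]) ^ n := ⟨a, by rw [mul_comm, h, mul_comm]⟩
  exact Polynomial.natDegree_le_of_dvd ((IsCoprime.pow_right (n := n) hcop).dvd_of_dvd_mul_right hdvd) hD

end Comparison

/-! ### Part 6: the pole bound for a smooth representation of `GL₂(F)` -/

section PoleBound

variable {F : Type*} [Field F] [ValuativeRel F] [TopologicalSpace F] [IsNonarchimedeanLocalField F]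
  {V : Type*} [AddCommGroup V] [Module ℂ V] (π : Representation ℂ (GL (Fin 2) F) V)

omit [ValuativeRel F] [TopologicalSpace F] [IsNonarchimedeanLocalField F] in
/-- Whittaker functions of the trivial representation of `GL₁(F)` on `ℂ` are constant. [folklore] -/
theorem whittakerModel_trivial_apply (Λ' : Module.Dual ℂ ℂ) (v' : ℂ) (g : GL (Fin 1) F) :
    whittakerModel (Representation.trivial ℂ (GL (Fin 1) F) ℂ) Λ' v' g = Λ' v' := by
  rw [whittakerModel_apply, Representation.trivial_apply]

variable [MeasurableSpace F] [BorelSpace F]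

/-- **Averaging over `d(𝒪ˣ, 1)` does not change the torus integral**: for `|u| = 1`,
`∫ W_{π(d(u,1)) v}(d(a,1)) κ |a|^c dμ' = ∫ W_v(d(a,1)) κ |a|^c dμ'` (`a ↦ a u`, `μ'` invariant).
[folklore] -/
theorem integral_whittakerModel_diagGL2_apply_eq (μ' : Measure Fˣ) [μ'.IsMulLeftInvariant]
    (Λ : Module.Dual ℂ V) (v : V) {u : Fˣ} (hu : normAbs F (u : F) = 1) (κ c : ℂ) :
    (∫ a, whittakerModel π Λ (π (diagGL2 u 1) v) (diagGL2 a 1) * κ *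
        (((normAbs F (a : F) : ℝ≥0) : ℝ) : ℂ) ^ c ∂μ') =
      ∫ a, whittakerModel π Λ v (diagGL2 a 1) * κ * (((normAbs F (a : F) : ℝ≥0) : ℝ) : ℂ) ^ c ∂μ' := by
  haveI : T2Space F :=
    (Literature.NumberTheory.GaloisRepresentations.IsNonarchimedeanLocalField.isLocalField F).toT2Space
  haveI : BorelSpace Fˣ := Units.borelSpace
  rw [← integral_mul_right_eq_self (fun a => whittakerModel π Λ v (diagGL2 a 1) * κ *
    (((normAbs F (a : F) : ℝ≥0) : ℝ) : ℂ) ^ c) u]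
  refine integral_congr_ae (Eventually.of_forall fun a => ?_)
  simp only [whittakerModel_diagGL2_diagGL2, Units.val_mul, map_mul, hu, mul_one]

/-- **The `GL₂ × GL₁` zeta integral against a constant `W'` is the torus integral**
`∫_{Fˣ} W(d(a,1)) κ |a|^{s-1/2} dμ'(a)` for the invariant measure `ν` on `GL₁(F) ⧸ U₁` transported
from a Haar measure `μ'` of `Fˣ` (after `a ↦ a⁻¹`). [folklore] -/
theorem rsZeta_eq_integral_torus
    [MeasurableSpace (GL (Fin 1) F ⧸ upperUnitriangular (Fin 1) F)]
    (μ' : Measure Fˣ) [μ'.IsHaarMeasure] (ν : Measure (GL (Fin 1) F ⧸ upperUnitriangular (Fin 1) F))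
    (hint : ∀ f : GL (Fin 1) F ⧸ upperUnitriangular (Fin 1) F → ℂ,
      ∫ x, f x ∂ν = ∫ a : Fˣ, f (QuotientGroup.mk (glDiagonal 1 F fun _ => a)) ∂μ')
    (W : GL (Fin 2) F → ℂ) {W' : GL (Fin 1) F → ℂ} {κ : ℂ} (hW' : ∀ g, W' g = κ) (s : ℂ) :
    rsZeta Nat.one_lt_two ν W W' s =
      ∫ a, W (diagGL2 a 1) * κ * (((normAbs F (a : F) : ℝ≥0) : ℝ) : ℂ) ^ (s - 1 / 2) ∂μ' := by
  haveI : T2Space F :=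
    (Literature.NumberTheory.GaloisRepresentations.IsNonarchimedeanLocalField.isLocalField F).toT2Space
  haveI : BorelSpace Fˣ := Units.borelSpace
  haveI := isInvInvariant_of_isHaarMeasure_units μ'
  have hker : ∀ a : Fˣ, rsKernel Nat.one_lt_two W W' s (QuotientGroup.mk (glDiagonal 1 F fun _ => a)) =
      W (diagGL2 a⁻¹ 1) * κ * (((normAbs F ((a⁻¹ : Fˣ) : F) : ℝ≥0) : ℝ) : ℂ) ^ (s - 1 / 2) := by
    intro a
    rw [rsKernel_mk_of_fin_one, rsIntegrand_glDiagonal_fin_one, hW']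
  rw [rsZeta, hint]
  simp_rw [hker]
  have hI := integral_inv_eq_self (fun a : Fˣ => W (diagGL2 a 1) * κ *
    (((normAbs F (a : F) : ℝ≥0) : ℝ) : ℂ) ^ (s - 1 / 2)) μ'
  exact hI

/-- **The pole bound** (the pole count of `L(s, π)` is at most the number of unramified exponents
of the Jacquet module — Jacquet–Langlands 1970, Prop. 3.5 with Props. 2.9–2.10; Godement 1970,
§1.3; Gelbart 1975, Thm. 6.15 for the resulting table).  Let `π` be a smooth representation of
`GL₂(F)` on `V` with finite-dimensional Jacquet module `V_N` (`U_id`-coinvariants), `ψ` continuous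
non-trivial, `H = d(𝒪ˣ, 1) ≤ GL₂(F)`, and `M ≤ V_N` the image of the `H`-fixed vectors.  Then for
the invariant measure `ν` on `GL₁(F) ⧸ U₁ = Fˣ` (transported Haar measure) every polynomial `P` with
`HasRSLFactor (1<2) π 1_{GL₁} ψ ν P` — `L(s, π × 1) = 1/P(q^{-s})` in the sense of JPSS — has
`deg P ≤ dim M`.  Proof: averaging a test vector over `H` does not change its zeta integral
(`integral_whittakerModel_diagGL2_apply_eq`), the averaged class lies in `M`, the torus recursion
with the characteristic polynomial `Q` of `d(ϖ, 1)` on `M` (`exists_monic_forall_sum_coeff_mul_whittakerModel_eq_zero`)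
makes `X^K D(X) Ψ(s)` a polynomial in `X = q^{-s}` with `D(X) = ∑ Q.coeff i · α^{d-i} X^{d-i}`
(`D(0) = 1`, `deg D ≤ dim M`; `exists_pow_mul_sum_mul_integral_eq_eval`), and the comparison with
clause (b) (`exists_X_pow_mul_eq_of_relations`) gives `P ∣ X^n D`, whence `deg P ≤ deg D`.
[cite: JacquetLanglands1970, Prop. 2.10, Prop. 3.5] [cite: JacquetPiatetskiShapiroShalika1983, Thm. 2.7 (ii)] -/
theorem natDegree_le_finrank_of_hasRSLFactor
    [MeasurableSpace (GL (Fin 1) F ⧸ upperUnitriangular (Fin 1) F)]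
    [BorelSpace (GL (Fin 1) F ⧸ upperUnitriangular (Fin 1) F)]
    (hπ : π.IsSmooth) {ψ : AddChar F Circle} (hψ : ψ.IsContinuousNontrivial)
    [FiniteDimensional ℂ (Representation.restrictUnipotentGL F (id : Fin 2 → Fin 2) π).Coinvariants]
    (H : Subgroup (GL (Fin 2) F))
    (hH : ∀ g : GL (Fin 2) F, g ∈ H ↔ ∃ u : Fˣ, valuation F (u : F) = 1 ∧ g = diagGL2 u 1) :
    ∃ ν : Measure (GL (Fin 1) F ⧸ upperUnitriangular (Fin 1) F),
      SMulInvariantMeasure (GL (Fin 1) F) (GL (Fin 1) F ⧸ upperUnitriangular (Fin 1) F) ν ∧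
      IsFiniteMeasureOnCompacts ν ∧ ν.IsOpenPosMeasure ∧
      ∀ P : ℂ[X], HasRSLFactor Nat.one_lt_two π (Representation.trivial ℂ (GL (Fin 1) F) ℂ) ψ ν P →
        P.natDegree ≤ Module.finrank ℂ
          (Submodule.map (Representation.Coinvariants.mk
            (Representation.restrictUnipotentGL F (id : Fin 2 → Fin 2) π)) (π.fixedPoints H)) := by
  classical
  haveI : T2Space F :=
    (Literature.NumberTheory.GaloisRepresentations.IsNonarchimedeanLocalField.isLocalField F).toT2Space
  haveI : BorelSpace Fˣ := Units.borelSpace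
  obtain ⟨μ', hμ', ν, hinv, hfin, hpos, hint⟩ := exists_haar_measure_quotient_fin_one (F := F)
  haveI := hμ'
  refine ⟨ν, hinv, hfin, hpos, fun P hP => ?_⟩
  -- notation
  set q : ℕ := residueFieldCard F with hq_def
  have hq : 1 < q := one_lt_residueFieldCard F
  set J := Representation.Coinvariants.mk (Representation.restrictUnipotentGL F (id : Fin 2 → Fin 2) π) with hJ
  set M : Submodule ℂ (Representation.restrictUnipotentGL F (id : Fin 2 → Fin 2) π).Coinvariants :=
    Submodule.map J (π.fixedPoints H) with hM_def
  -- a uniformiser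
  obtain ⟨ϖ₀, hϖ₀0, hϖ₀⟩ := exists_normAbs_eq_inv (F := F)
  set ϖ : Fˣ := Units.mk0 ϖ₀ hϖ₀0 with hϖ_def
  have hϖ : normAbs F (ϖ : F) = (residueFieldCard F : ℝ≥0)⁻¹ := hϖ₀
  -- `M` is stable under `d(ϖ, 1)` (the torus is commutative)
  have hcomm : ∀ u : Fˣ, diagGL2 u 1 * diagGL2 ϖ 1 = diagGL2 ϖ 1 * diagGL2 u 1 := fun u => by
    rw [← diagGL2_mul, ← diagGL2_mul, mul_comm]
  have hfixT : ∀ v₀ ∈ π.fixedPoints H, π (diagGL2 ϖ 1) v₀ ∈ π.fixedPoints H := by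
    intro v₀ hv₀
    rw [Representation.mem_fixedPoints] at hv₀ ⊢
    intro g hg
    obtain ⟨u, -, rfl⟩ := (hH g).1 hg
    rw [← Module.End.mul_apply, ← map_mul, hcomm, map_mul, Module.End.mul_apply, hv₀ _ hg]
  have hM : ∀ v : V, J v ∈ M → J (π (diagGL2 ϖ 1) v) ∈ M := by
    intro v hv
    obtain ⟨v₀, hv₀, hv₀v⟩ := Submodule.mem_map.1 hv
    have h1 : J (π (diagGL2 ϖ 1) v) = J (π (diagGL2 ϖ 1) v₀) := by
      rw [hJ, ← jacquetGL_leviProjection_diagGL2_mk, ← jacquetGL_leviProjection_diagGL2_mk]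
      exact congrArg _ hv₀v.symm
    rw [h1]
    exact Submodule.mem_map_of_mem (hfixT v₀ hv₀)
  -- the recursion polynomials: `Q` on `M`, `Q'` on all of `V_N`
  obtain ⟨Q, hQm, hQd, hQ⟩ := exists_monic_forall_sum_coeff_mul_whittakerModel_eq_zero π hψ ϖ M hM
  obtain ⟨Q', hQ'm, -, hQ'⟩ := exists_monic_forall_sum_coeff_mul_whittakerModel_eq_zero π hψ ϖ ⊤
    (fun _ _ => Submodule.mem_top)
  -- the constants `α`, `X = q^{-s}`, `Y = α X`
  have hr0 : (0 : ℝ) < (((residueFieldCard F : ℝ≥0)⁻¹ : ℝ≥0) : ℝ) := by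
    exact_mod_cast inv_residueFieldCard_pos (F := F)
  set α : ℂ := ((((residueFieldCard F : ℝ≥0)⁻¹ : ℝ≥0) : ℝ) : ℂ) ^ (-(1 / 2 : ℂ)) with hα
  have hα0 : α ≠ 0 := by
    rw [hα, Ne, Complex.cpow_eq_zero_iff, not_and_or]
    exact Or.inl (by exact_mod_cast hr0.ne')
  have hY : ∀ s : ℂ, ((((residueFieldCard F : ℝ≥0)⁻¹ : ℝ≥0) : ℝ) : ℂ) ^ (s - 1 / 2) =
      α * (q : ℂ) ^ (-s) := by
    intro s
    have hxq : ((((residueFieldCard F : ℝ≥0)⁻¹ : ℝ≥0) : ℝ) : ℂ) = ((residueFieldCard F : ℂ))⁻¹ := by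
      rw [NNReal.coe_inv, NNReal.coe_natCast, Complex.ofReal_inv, Complex.ofReal_natCast]
    have hxne : ((((residueFieldCard F : ℝ≥0)⁻¹ : ℝ≥0) : ℝ) : ℂ) ≠ 0 := Complex.ofReal_ne_zero.2 hr0.ne'
    have hxs' : ((((residueFieldCard F : ℝ≥0)⁻¹ : ℝ≥0) : ℝ) : ℂ) ^ s = (residueFieldCard F : ℂ) ^ (-s) := by
      rw [hxq, Complex.inv_cpow _ _ (by rw [Complex.natCast_arg]; exact Real.pi_ne_zero.symm),
        Complex.cpow_neg]
    rw [show s - 1 / 2 = -(1 / 2 : ℂ) + s by ring, Complex.cpow_add _ _ hxne, hxs']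
  -- normalise `Q.natDegree` to a variable `d`
  obtain ⟨d, hd⟩ : ∃ d : ℕ, Q.natDegree = d := ⟨_, rfl⟩
  simp only [hd] at hQ
  have hcd : Q.coeff d = 1 := by rw [← hd]; exact hQm.coeff_natDegree
  have hcd' : Q'.coeff Q'.natDegree = 1 := hQ'm.coeff_natDegree
  -- the polynomial `D(X) = ∑ Q.coeff i · α^{d-i} X^{d-i}` (`D(0) = 1`, `deg D ≤ d`)
  set D : ℂ[X] := ∑ i ∈ Finset.range (d + 1), C (Q.coeff i * α ^ (d - i)) * X ^ (d - i) with hD_def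
  have hDeval : ∀ x : ℂ, D.eval x = ∑ i ∈ Finset.range (d + 1), Q.coeff i * (α * x) ^ (d - i) := by
    intro x
    rw [hD_def, Polynomial.eval_finsetSum]
    refine Finset.sum_congr rfl fun i _ => ?_
    rw [Polynomial.eval_mul, Polynomial.eval_C, Polynomial.eval_pow, Polynomial.eval_X, mul_pow,
      mul_assoc]
  have hD0 : D.eval 0 ≠ 0 := by
    rw [hDeval, Finset.sum_eq_single d, hcd, Nat.sub_self, pow_zero, mul_one]
    · exact one_ne_zero
    · intro i hi hid
      have h : d - i ≠ 0 := by have := Finset.mem_range.1 hi; omega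
      rw [mul_zero, zero_pow h, mul_zero]
    · intro h; exact absurd (Finset.mem_range.2 (Nat.lt_succ_self d)) h
  have hDne : D ≠ 0 := fun h => hD0 (by rw [h, Polynomial.eval_zero])
  have hDdeg : D.natDegree ≤ d := by
    rw [hD_def]
    refine Polynomial.natDegree_sum_le_of_forall_le _ _ fun i _ => ?_
    exact (Polynomial.natDegree_C_mul_X_pow_le _ _).trans (Nat.sub_le d i)
  -- clause (b) of the `L`-factor and the compact set `d(𝒪ˣ, 1) ⊇ H`
  obtain ⟨k, Λb, Λ'b, vb, v'b, Qb, hΛb, -, hQb, c₀, hb⟩ := hP.2.2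
  have hC : IsCompact ((fun u : Fˣ => (diagGL2 u 1 : GL (Fin 2) F)) '' {u : Fˣ | valuation F (u : F) = 1}) :=
    (isCompact_units_valuation_eq_one (F := F)).image (continuous_unitsDiagGL2_one (F := F))
  have hHC : (H : Set (GL (Fin 2) F)) ⊆
      (fun u : Fˣ => (diagGL2 u 1 : GL (Fin 2) F)) '' {u : Fˣ | valuation F (u : F) = 1} := by
    intro g hg
    obtain ⟨u, hu, rfl⟩ := (hH g).1 hg
    exact ⟨u, hu, rfl⟩
  -- the relation `X^K D(X) Ψ_i(s) = p_i(X)` for each test datum of clause (b)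
  have hrel : ∀ i : Fin k, ∃ (K : ℕ) (p : ℂ[X]) (σ : ℝ), ∀ s : ℂ, σ < s.re →
      ((q : ℂ) ^ (-s)) ^ K * D.eval ((q : ℂ) ^ (-s)) *
        rsZeta Nat.one_lt_two ν (whittakerModel π (Λb i) (vb i))
          (whittakerModel (Representation.trivial ℂ (GL (Fin 1) F) ℂ) (Λ'b i) (v'b i)) s =
      p.eval ((q : ℂ) ^ (-s)) := by
    intro i
    have hW' : ∀ g, whittakerModel (Representation.trivial ℂ (GL (Fin 1) F) ℂ) (Λ'b i) (v'b i) g =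
        Λ'b i (v'b i) := fun g => whittakerModel_trivial_apply _ _ g
    -- averaging the test vector over `H`
    obtain ⟨S, hSne, hSmem, hSfix⟩ := JacquetLemma.exists_average_mem_fixedPoints π H hC hHC (hπ (vb i))
    have hwM : J ((S.card : ℂ)⁻¹ • ∑ y ∈ S, y) ∈ M := Submodule.mem_map_of_mem hSfix
    -- recursion, support and continuity for the averaged Whittaker function
    obtain ⟨kr, hkr⟩ := hQ (hΛb i) _ hwM
    obtain ⟨k₁, hk₁⟩ := exists_whittakerModel_diagGL2_eq_zero_of_not_mem π hψ (hΛb i)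
      (hπ ((S.card : ℂ)⁻¹ • ∑ y ∈ S, y))
    have hcw : Continuous fun a : Fˣ =>
        whittakerModel π (Λb i) ((S.card : ℂ)⁻¹ • ∑ y ∈ S, y) (diagGL2 a 1) :=
      (isLocallyConstant_whittakerModel_diagGL2 π (Λb i) (hπ _)).continuous
    obtain ⟨K, p, σ₀, hKp⟩ := exists_pow_mul_sum_mul_integral_eq_eval μ'
      (Φ := fun a : Fˣ => whittakerModel π (Λb i) ((S.card : ℂ)⁻¹ • ∑ y ∈ S, y) (diagGL2 a 1))
      hcw hk₁ hϖ (c := fun j => Q.coeff j) hcd hkr (Λ'b i (v'b i))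
    -- growth bound for the original test vector (for integrability)
    obtain ⟨kr', hkr'⟩ := hQ' (hΛb i) (vb i) Submodule.mem_top
    obtain ⟨k₁', hk₁'⟩ := exists_whittakerModel_diagGL2_eq_zero_of_not_mem π hψ (hΛb i) (hπ (vb i))
    have hcv : Continuous fun a : Fˣ => whittakerModel π (Λb i) (vb i) (diagGL2 a 1) :=
      (isLocallyConstant_whittakerModel_diagGL2 π (Λb i) (hπ _)).continuous
    obtain ⟨C₁, N, hle⟩ := exists_norm_le_indicator_rpow_of_recursion
      (Φ := fun a : Fˣ => whittakerModel π (Λb i) (vb i) (diagGL2 a 1))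
      hcv hk₁' hϖ (c := fun j => Q'.coeff j) hcd' hkr'
    -- the averaged torus integral equals the original one
    have havg : ∀ s : ℂ, (N : ℝ) + 1 / 2 < s.re →
        (∫ a, whittakerModel π (Λb i) ((S.card : ℂ)⁻¹ • ∑ y ∈ S, y) (diagGL2 a 1) * Λ'b i (v'b i) *
            (((normAbs F (a : F) : ℝ≥0) : ℝ) : ℂ) ^ (s - 1 / 2) ∂μ') =
          ∫ a, whittakerModel π (Λb i) (vb i) (diagGL2 a 1) * Λ'b i (v'b i) *
            (((normAbs F (a : F) : ℝ≥0) : ℝ) : ℂ) ^ (s - 1 / 2) ∂μ' := by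
      intro s hs
      have hfi : Integrable (fun a : Fˣ => whittakerModel π (Λb i) (vb i) (diagGL2 a 1) * Λ'b i (v'b i) *
          (((normAbs F (a : F) : ℝ≥0) : ℝ) : ℂ) ^ (s - 1 / 2)) μ' :=
        integrable_mul_cpow_of_norm_le μ' hcv hle _ hs
      have hyS : ∀ y ∈ S, ∃ u : Fˣ, normAbs F (u : F) = 1 ∧ π (diagGL2 u 1) (vb i) = y := by
        intro y hy
        obtain ⟨h, hh, rfl⟩ := hSmem y hy
        obtain ⟨u, hu, rfl⟩ := (hH h).1 hh
        exact ⟨u, (normAbs_eq_one_iff_valuation_eq_one (F := F)).2 hu, rfl⟩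
      have hyI : ∀ y ∈ S, Integrable (fun a : Fˣ => whittakerModel π (Λb i) y (diagGL2 a 1) *
          Λ'b i (v'b i) * (((normAbs F (a : F) : ℝ≥0) : ℝ) : ℂ) ^ (s - 1 / 2)) μ' := by
        intro y hy
        obtain ⟨u, hu, rfl⟩ := hyS y hy
        have hf := hfi.comp_mul_right u
        refine hf.congr (Eventually.of_forall fun a => ?_)
        simp only [whittakerModel_diagGL2_diagGL2, Units.val_mul, map_mul, hu, mul_one]
      have hyE : ∀ y ∈ S, (∫ a, whittakerModel π (Λb i) y (diagGL2 a 1) * Λ'b i (v'b i) *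
            (((normAbs F (a : F) : ℝ≥0) : ℝ) : ℂ) ^ (s - 1 / 2) ∂μ') =
          ∫ a, whittakerModel π (Λb i) (vb i) (diagGL2 a 1) * Λ'b i (v'b i) *
            (((normAbs F (a : F) : ℝ≥0) : ℝ) : ℂ) ^ (s - 1 / 2) ∂μ' := by
        intro y hy
        obtain ⟨u, hu, rfl⟩ := hyS y hy
        exact integral_whittakerModel_diagGL2_apply_eq π μ' (Λb i) (vb i) hu _ _
      have hfun : (fun a : Fˣ => whittakerModel π (Λb i) ((S.card : ℂ)⁻¹ • ∑ y ∈ S, y) (diagGL2 a 1) *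
            Λ'b i (v'b i) * (((normAbs F (a : F) : ℝ≥0) : ℝ) : ℂ) ^ (s - 1 / 2)) =
          fun a => (S.card : ℂ)⁻¹ * ∑ y ∈ S, whittakerModel π (Λb i) y (diagGL2 a 1) *
            Λ'b i (v'b i) * (((normAbs F (a : F) : ℝ≥0) : ℝ) : ℂ) ^ (s - 1 / 2) := by
        funext a
        rw [map_smul, map_sum, Pi.smul_apply, Finset.sum_apply, smul_eq_mul, Finset.mul_sum,
          Finset.sum_mul, Finset.sum_mul, Finset.mul_sum]
        refine Finset.sum_congr rfl fun y _ => ?_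
        ring
      rw [hfun, integral_const_mul, integral_finsetSum _ hyI, Finset.sum_congr rfl hyE,
        Finset.sum_const, nsmul_eq_mul, ← mul_assoc, inv_mul_cancel₀
          (Nat.cast_ne_zero.2 (Finset.card_pos.2 hSne).ne'), one_mul]
    -- assemble the relation
    refine ⟨K, Polynomial.C (α ^ K)⁻¹ * p.comp (Polynomial.C α * X), max σ₀ ((N : ℝ) + 1 / 2),
      fun s hs => ?_⟩
    have hs₀ : σ₀ < s.re := lt_of_le_of_lt (le_max_left _ _) hs
    have hsN : (N : ℝ) + 1 / 2 < s.re := lt_of_le_of_lt (le_max_right _ _) hs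
    have hz := rsZeta_eq_integral_torus μ' ν hint (whittakerModel π (Λb i) (vb i)) hW' s
    have hK := hKp s hs₀
    rw [havg s hsN, hY s, mul_pow, ← hDeval] at hK
    rw [hz, Polynomial.eval_mul, Polynomial.eval_C, Polynomial.eval_comp, Polynomial.eval_mul,
      Polynomial.eval_C, Polynomial.eval_X, ← hK]
    simp only [mul_assoc]
    rw [inv_mul_cancel_left₀ (pow_ne_zero K hα0)]
  -- conclusion: `P ∣ X^n D`, so `deg P ≤ deg D ≤ d = dim M`
  obtain ⟨a, n, han⟩ := exists_X_pow_mul_eq_of_relations hq (P := P)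
    (fun h => by have h1 := hP.1; rw [h, Polynomial.eval_zero] at h1; exact zero_ne_one h1)
    (fun i s => rsZeta Nat.one_lt_two ν (whittakerModel π (Λb i) (vb i))
      (whittakerModel (Representation.trivial ℂ (GL (Fin 1) F) ℂ) (Λ'b i) (v'b i)) s)
    Qb hQb hb D hrel
  have hP0 : P.eval 0 ≠ 0 := by rw [hP.1]; exact one_ne_zero
  calc P.natDegree ≤ D.natDegree := natDegree_le_of_X_pow_mul_eq hP0 hDne han
    _ ≤ d := hDdeg
    _ = Module.finrank ℂ M := by rw [← hd, hQd]

end PoleBound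

end Literature.NumberTheory.Automorphic

end
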